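import Literature.Probability.RandomPlanarGeometry.HexSAWBrickWallWalks
import Literature.Probability.RandomPlanarGeometry.SAWBridgeRenewalEquation
import Literature.Probability.RandomPlanarGeometry.SAWAdsorptionArchUnfolding
import Literature.Probability.RandomPlanarGeometry.HexSAWHammersleyWelshSix
import Mathlib.Analysis.Subadditive
import Mathlib.Analysis.SpecialFunctions.Pow.Real
import HarnessLib

/-!
# Honeycomb SAW at Beaton's ROTATED (armchair) surface, brick-wall frame, I: armchair wall bridges, their growth rate `β_rot(y)`,
# and `C^w_n(y) ≤ Σ_k A_k(y) c_{n-k}(ℍ)`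

Topic `Literature/Probability/RandomPlanarGeometry` (lane «pcv-sawmu», door «HEX-YC-ROT-LIMIT-ALL-Y», Part A; continues
`HexSAWBrickWallWalks.lean` — the brick wall `brickWallGraph` (vertical bonds `{(x,y),(x,y+1)}` with `x + y` even), `HexBW.saws n`,
`card_saws : #(saws n) = c_n(ℍ)`, `twistAt` —, `SAWAdsorptionArchUnfolding.lean` — `Zd.prefixWalk`, `Zd.suffixWalk`,
`Zd.prefix_suffix_injOn` —, `SAWBridgeRenewalEquation.lean` — `Zd.concatWalk_apply_*`, `Zd.concatWalk_injective_pieces` — and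
`HexSAWHammersleyWelshSix.lean` — `c_n(ℍ) ≤ μ e^{6√n} μ^n`).  The rotated-frame consumer (`C⁺_{n+1}(y) = C^w_n(y)` under the chart
`HV.toSlabBW`, `X = −ξ`) is `HexSAWRotSurfaceArmchairDictionary.lean`.

Sources. N. R. Beaton, *The critical surface fugacity of self-avoiding walks on a rotated honeycomb lattice*, J. Phys. A 47 (2014)
075003, arXiv:1210.0274v3, §3.1 (p. 11: `c^+_n(m)`, `C^+_n(y) = Σ_m c^+_n(m) y^m`; Proposition 7 (p. 11) and its proof (pp. 12–14): unfolded
walks `U^+_n(y)` — "a SAW whose origin and end-point have minimal and maximal x-coordinates respectively … they can be concatenated freely"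
(p. 11), "when concatenating unfolded walks on the honeycomb lattice, the addition of one or two mid-edges at the point of concatenation may be
necessary" (p. 12), "`μ(y) = lim U_n^+(y)^{1/n}` exists" (p. 12), "`U^+_n(y) ≤ C^+_n(y)`" (p. 14), "the lower bound `μ(y) ≥ √y` is obtained by
considering walks which step along the surface" (p. 14)).  J. M. Hammersley, G. M. Torrie, S. G. Whittington, J. Phys. A 15 (1982) 539, §2 (as summarised by Beaton, arXiv
v3 p. 11: unfolded surface walks, supermultiplicativity, decomposition at the last surface contact; section number unverified, source not held).  N. Madras, G. Slade, *The Self-Avoiding Walk* (1993), §1.2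
((1.2.15)–(1.2.17), Lemma 1.2.2 = Fekete).  I. G. Enting, I. Jensen, LNP 775 (2009), §7.4.2, Fig. 7.10 (brickwork form of the honeycomb
lattice).

## The frame

Under the tree's chart `HV.toSlabBW = hvToBW ∘ ρ⁻¹` (`HexSAWRotSlabSummable.lean`; `toSlabBW_zero : X = −ξ`) Beaton's half-plane
`{ξ ≤ 0}` is the brick-wall half-plane `{X ≥ 0}` and his surface `{ξ = 0}` is the COLUMN `{X = 0}` — an ARMCHAIR line: its vertices come
in dimers `{(0,2k),(0,2k+1)}`.  Along this wall the lattice symmetries fixing `X` are the even shifts `Y ↦ Y + 2k` (`adj_shiftY_iff`) and the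
HALF-INTEGER mirrors `Y ↦ c − Y`, `c` odd (`adj_flipY_iff`) — no mirror through a vertex, which is why Beaton's unfolding inserts edges
(Part B) and why concatenation needs the connector below.

## What is proved (all PROVED; namespace `…SAW.HexBW.Arm`)

* classes and weights: `visits` (wall vertices, start included = Beaton's `m`), `hp n` / `arches n` / `wb n` (half-plane walks from
  `0`, those ending on the wall, ARMCHAIR WALL BRIDGES: `0 = Y_0 < Y_i < Y_n` for `0 < i < n`), `Cw`, `Aw`, `WB`; the surface zig-zag
  `zzWalk` and `WB_pos : B^w_{4k+1}(y) > 0`; `wb_end_odd` (a wall bridge ends at the upper vertex of a dimer), `odd_of_mem_wb`;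
* **`mul_WB_le : B^w_{n₁}(y) B^w_{n₂}(y) ≤ B^w_{n₁+3+n₂}(y)`** — concatenation through the connector `(0,M) → (1,M) → (1,M+1) → (0,M+1)`
  and an even shift (`jcat_spec`), visits additive; `WB_sq_le : B^w_n(y)² ≤ B^w_{2n+3}(y)`; `WB_le_Cw_add : B^w_m(y) ≤ C^w_{m+j}(y)`;
* Fekete on `d_k = B^w_{4k−3}(y)`: **`armRate y = β_rot(y) := lim_k d_k^{1/(4k)}`**, `armRate_pos`, `WB_le_pow : B^w_n(y) ≤ β_rot(y)^{n+3}`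
  for EVERY `n`, `eventually_pow_le_wseq`, **`eventually_mul_pow_le_Cw`** (`liminf C^w_n(y)^{1/n} ≥ β_rot(y)`, rate form);
* **`Cw_le_sum : C^w_n(y) ≤ Σ_{k ≤ n} A_k(y) · c_{n−k}(ℍ)`** (split at the last wall visit; the suffix is read with the parity twist);
* the face **`ArchBound y`** («ARM-ARCH-BOUND»: `∀ r > β_rot(y), ∃ C, ∀ n, A_n(y) ≤ C rⁿ`, discharged in `HexSAWArmchairUnfolding.lean`) and,
  GIVEN it, `Cw_le_of_archBound`, **`eventually_Cw_le_pow : max(β_rot(y), μ) < r → ∀ᶠ n, C^w_n(y) ≤ rⁿ`**; `exists_hexSawCount_le_pow`.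

LABEL: CONSOLIDATION BY A DIFFERENT (ELSEWHERE-PRINTED) DEVICE of the «unfolded class» half of Beaton 2014 Prop. 7's proof (lit-1 g14,
2026-08-23: print gives this step by reference to HTW82, p. 12; the file writes it for armchair WALL BRIDGES with the explicit 3-site
connector and Fekete super-multiplicativity in the Madras–Slade (1.2.15)–(1.2.17) / Lemma 1.2.2 pattern; the connector `(1,M),(1,M+1)`
realises Beaton's "one or two mid-edges at the point of concatenation").  No statement of this file is claimed new in print terms.
EDITION ed.2 (2026-08-23, a-p6 g10): docstring-only — lit-1 g14's page-token table T1–T11 (Beaton v3 PDF pages: Prop. 7 p. 11, proof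
pp. 12–14) and the HTW82 provisional note folded; code identical to ed.1 74b400692a3b380c.
-/

noncomputable section

open Finset Filter Function
open Literature.Probability.LatticeModels Literature.Probability.Percolation SimpleGraph
open _root_.Topology

namespace Literature.Probability.RandomPlanarGeometry.SAW.HexBW.Arm

variable {y : ℝ} {n : ℕ} {ω : ℕ → Site 2}

/-! ### Arithmetic of the armchair wall: even shifts along the wall and half-integer mirrors -/

/-- The shift by `b` along the wall (`(X, Y) ↦ (X, Y + b)`). [cite: Beaton2014RotatedHoneycomb, §3.1 (arXiv v3 p. 11: the surface of the half-space)] -/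
def shiftY (b : ℤ) (x : Site 2) : Site 2 := Function.update x 1 (x 1 + b)

/-- The mirror `(X, Y) ↦ (X, c − Y)` in the line `Y = c/2` perpendicular to the wall. [cite: Beaton2014RotatedHoneycomb, §3.1 (arXiv v3 p. 12: "reflection through a vertical line")] -/
def flipY (c : ℤ) (x : Site 2) : Site 2 := Function.update x 1 (c - x 1)

/-- `shiftY` fixes the wall coordinate. [cite: EntingJensen2009, §7.4.2, Fig. 7.10 (brickwork form of the honeycomb lattice)] -/
@[simp] theorem shiftY_apply_zero (b : ℤ) (x : Site 2) : shiftY b x 0 = x 0 := by simp [shiftY]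
/-- `shiftY` on the coordinate along the wall. [cite: EntingJensen2009, §7.4.2, Fig. 7.10 (brickwork form of the honeycomb lattice)] -/
@[simp] theorem shiftY_apply_one (b : ℤ) (x : Site 2) : shiftY b x 1 = x 1 + b := by simp [shiftY]
/-- `flipY` fixes the wall coordinate. [cite: EntingJensen2009, §7.4.2, Fig. 7.10 (brickwork form of the honeycomb lattice)] -/
@[simp] theorem flipY_apply_zero (c : ℤ) (x : Site 2) : flipY c x 0 = x 0 := by simp [flipY]
/-- `flipY` on the coordinate along the wall. [cite: EntingJensen2009, §7.4.2, Fig. 7.10 (brickwork form of the honeycomb lattice)] -/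
@[simp] theorem flipY_apply_one (c : ℤ) (x : Site 2) : flipY c x 1 = c - x 1 := by simp [flipY]

/-- `flipY c` is an involution. [cite: EntingJensen2009, §7.4.2, Fig. 7.10 (brickwork form of the honeycomb lattice)] -/
@[simp] theorem flipY_flipY (c : ℤ) (x : Site 2) : flipY c (flipY c x) = x := by
  rw [site_two_eq_iff]; simp

/-- `flipY c` is injective. [cite: EntingJensen2009, §7.4.2, Fig. 7.10 (brickwork form of the honeycomb lattice)] -/
theorem flipY_injective (c : ℤ) : Function.Injective (flipY c) := fun x z h => by
  rw [← flipY_flipY c x, h, flipY_flipY]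

/-- `shiftY (-b)` undoes `shiftY b`. [cite: EntingJensen2009, §7.4.2, Fig. 7.10 (brickwork form of the honeycomb lattice)] -/
@[simp] theorem shiftY_neg_shiftY (b : ℤ) (x : Site 2) : shiftY (-b) (shiftY b x) = x := by
  rw [site_two_eq_iff]; simp

/-- `shiftY b` is injective. [cite: EntingJensen2009, §7.4.2, Fig. 7.10 (brickwork form of the honeycomb lattice)] -/
theorem shiftY_injective (b : ℤ) : Function.Injective (shiftY b) := fun x z h => by
  rw [← shiftY_neg_shiftY b x, h, shiftY_neg_shiftY]

/-- **An EVEN shift along the wall is an automorphism of the brick wall.** [cite: EntingJensen2009, §7.4.2, Fig. 7.10 (brickwork form of the honeycomb lattice)] -/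
theorem adj_shiftY_iff {b : ℤ} (hb : b % 2 = 0) (x z : Site 2) :
    brickWallGraph.Adj (shiftY b x) (shiftY b z) ↔ brickWallGraph.Adj x z := by
  simp only [brickWallGraph_adj_coord, shiftY_apply_zero, shiftY_apply_one]
  omega

/-- **The mirror `Y ↦ c − Y` is an automorphism of the brick wall iff `c` is ODD** — there is no mirror perpendicular to the
armchair wall through a vertex ("the lattice is not invariant under reflection through a vertical line passing through a vertex").
[cite: Beaton2014RotatedHoneycomb, §3.1 (arXiv v3 p. 12)] -/
theorem adj_flipY_iff {c : ℤ} (hc : c % 2 = 1) (x z : Site 2) :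
    brickWallGraph.Adj (flipY c x) (flipY c z) ↔ brickWallGraph.Adj x z := by
  simp only [brickWallGraph_adj_coord, flipY_apply_zero, flipY_apply_one]
  omega

/-- The type of a site: `X + Y` even ⇔ its vertical bond goes UP (`(X,Y) ∼ (X,Y+1)`), odd ⇔ it goes DOWN. [cite: EntingJensen2009, §7.4.2, Fig. 7.10] -/
theorem adj_up_iff (x : Site 2) : brickWallGraph.Adj x (shiftY 1 x) ↔ (x 0 + x 1) % 2 = 0 := by
  rw [brickWallGraph_adj_coord, shiftY_apply_zero, shiftY_apply_one]
  omega

/-- A step changes `Y` by at most one and, if it changes `Y`, keeps `X`. [cite: EntingJensen2009, §7.4.2, Fig. 7.10] -/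
theorem step_cases {x z : Site 2} (h : brickWallGraph.Adj x z) :
    (z 1 = x 1 ∧ (z 0 = x 0 + 1 ∨ x 0 = z 0 + 1)) ∨ (z 0 = x 0 ∧ z 1 = x 1 + 1 ∧ (x 0 + x 1) % 2 = 0) ∨
      (z 0 = x 0 ∧ x 1 = z 1 + 1 ∧ (z 0 + z 1) % 2 = 0) := by
  rw [brickWallGraph_adj_coord] at h
  omega

/-! ### Surface visits -/

/-- **Number of visits to the wall `X = 0` at times `0, …, n`** (the starting vertex included, as in Beaton's `m`).
[cite: Beaton2014RotatedHoneycomb, §3.1 (arXiv v3 p. 11: "occupying m vertices in the surface")] -/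
def visits : ℕ → (ℕ → Site 2) → ℕ
  | 0, ω => if ω 0 0 = 0 then 1 else 0
  | n + 1, ω => visits n ω + (if ω (n + 1) 0 = 0 then 1 else 0)

/-- `visits 0`. [cite: Beaton2014RotatedHoneycomb, §3.1 (arXiv v3 p. 11: "occupying m vertices in the surface")] -/
theorem visits_zero (ω : ℕ → Site 2) : visits 0 ω = if ω 0 0 = 0 then 1 else 0 := rfl

/-- The recursion for `visits`. [cite: Beaton2014RotatedHoneycomb, §3.1 (arXiv v3 p. 11: "occupying m vertices in the surface")] -/
theorem visits_succ (n : ℕ) (ω : ℕ → Site 2) :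
    visits (n + 1) ω = visits n ω + (if ω (n + 1) 0 = 0 then 1 else 0) := rfl

/-- `visits n ω ≤ n + 1`. [cite: Beaton2014RotatedHoneycomb, §3.1 (arXiv v3 p. 11: "occupying m vertices in the surface")] -/
theorem visits_le (n : ℕ) (ω : ℕ → Site 2) : visits n ω ≤ n + 1 := by
  induction n with
  | zero => rw [visits_zero]; split_ifs <;> omega
  | succ n ih => rw [visits_succ]; split_ifs <;> omega

/-- `visits n` depends only on `X_0, …, X_n`. [cite: Beaton2014RotatedHoneycomb, §3.1 (arXiv v3 p. 11: "occupying m vertices in the surface")] -/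
theorem visits_congr {n : ℕ} {ω ξ : ℕ → Site 2} (h : ∀ i ≤ n, ω i 0 = ξ i 0) : visits n ω = visits n ξ := by
  induction n with
  | zero => rw [visits_zero, visits_zero, h 0 le_rfl]
  | succ n ih => rw [visits_succ, visits_succ, ih (fun i hi => h i (by omega)), h (n + 1) le_rfl]

/-- Additivity of `visits` over a cut: times `0..a` read on `ζ`, times `a+1..a+b` read on `ξ` at `1..b`. [cite: Beaton2014RotatedHoneycomb, §3.1 (arXiv v3 p. 11: "occupying m vertices in the surface")] -/
theorem visits_add {a b : ℕ} {ζ ξ : ℕ → Site 2} (h : ∀ j, 1 ≤ j → j ≤ b → ζ (a + j) 0 = ξ j 0) :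
    visits (a + b) ζ + (if ξ 0 0 = 0 then 1 else 0) = visits a ζ + visits b ξ := by
  induction b with
  | zero => simp [visits_zero]
  | succ b ih =>
    have e := h (b + 1) (by omega) le_rfl
    rw [← add_assoc] at e
    rw [← add_assoc, visits_succ, visits_succ, e]
    have := ih (fun j h1 hj => h j h1 (by omega))
    omega

/-- A stretch without visits: `visits (k + b) = visits k`. [cite: Beaton2014RotatedHoneycomb, §3.1 (arXiv v3 p. 11: "occupying m vertices in the surface")] -/
theorem visits_add_eq_left {k b : ℕ} {ζ : ℕ → Site 2} (h : ∀ j, 1 ≤ j → j ≤ b → ζ (k + j) 0 ≠ 0) :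
    visits (k + b) ζ = visits k ζ := by
  induction b with
  | zero => rfl
  | succ b ih =>
    have e := h (b + 1) (by omega) le_rfl
    rw [← add_assoc] at e
    rw [← add_assoc, visits_succ, ih (fun j h1 hj => h j h1 (by omega)), if_neg e, add_zero]

/-- Monotonicity in time. [cite: Beaton2014RotatedHoneycomb, §3.1 (arXiv v3 p. 11: "occupying m vertices in the surface")] -/
theorem visits_mono {k m : ℕ} (h : k ≤ m) (ζ : ℕ → Site 2) : visits k ζ ≤ visits m ζ := by
  induction m with
  | zero => rw [Nat.le_zero.1 h]
  | succ m ih =>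
    rcases Nat.lt_or_ge k (m + 1) with hk | hk
    · exact (ih (by omega)).trans (by rw [visits_succ]; omega)
    · rw [le_antisymm h hk]

/-- Visits along a stretch grow at most like its length. [cite: Beaton2014RotatedHoneycomb, §3.1 (arXiv v3 p. 11: "occupying m vertices in the surface")] -/
theorem visits_add_le (k b : ℕ) (ζ : ℕ → Site 2) : visits (k + b) ζ ≤ visits k ζ + b := by
  induction b with
  | zero => simp
  | succ b ih => rw [← add_assoc, visits_succ]; split_ifs <;> omega

/-! ### Half-plane walks from the wall, arches, armchair wall bridges and their weights -/

/-- The walk stays in Beaton's half-plane `X ≥ 0` up to time `n` (the wall is the armchair column `X = 0`).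
[cite: Beaton2014RotatedHoneycomb, §3.1 (arXiv v3 p. 11: "SAWs starting on the boundary of the half-space")] -/
def InH (n : ℕ) (ω : ℕ → Site 2) : Prop := ∀ i ≤ n, 0 ≤ ω i 0

/-- **Armchair wall bridge** condition: strictly above the start and strictly below the end at all interior times, and a positive
end level (`0 = Y_0 < Y_i < Y_n`, `0 < i < n`).
[cite: HammersleyTorrieWhittington1982, §2 (unfolded walks terminally attached to the surface); Beaton2014RotatedHoneycomb, §3.1 (arXiv v3 p. 11: "unfolded walk"; honeycomb version p. 12)] -/
def IsWB (n : ℕ) (ω : ℕ → Site 2) : Prop := 0 < ω n 1 ∧ ∀ i, 1 ≤ i → i < n → 0 < ω i 1 ∧ ω i 1 < ω n 1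

open Classical in
/-- `C`-class: `n`-step half-plane walks from the wall vertex `0`. [cite: Beaton2014RotatedHoneycomb, §3.1 (arXiv v3 p. 11: c^+_n(m))] -/
def hp (n : ℕ) : Finset (ℕ → Site 2) := (saws n).filter (InH n)

open Classical in
/-- `A`-class (arches): half-plane walks from `0` ending on the wall. [cite: HammersleyTorrieWhittington1982, §2 (walks with last vertex in the surface)] -/
def arches (n : ℕ) : Finset (ℕ → Site 2) := (hp n).filter fun ω => ω n 0 = 0

open Classical in
/-- `B^w`-class: armchair wall bridges. [cite: HammersleyTorrieWhittington1982, §2 (unfolded walks); Beaton2014RotatedHoneycomb, §3.1 (arXiv v3 p. 12)] -/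
def wb (n : ℕ) : Finset (ℕ → Site 2) := (arches n).filter (IsWB n)

/-- Membership in `hp`. [cite: Beaton2014RotatedHoneycomb, §3.1 (arXiv v3 p. 11: c^+_n(m), C^+_n(y), unfolded walks; proof of Proposition 7 pp. 12–14)] -/
theorem mem_hp : ω ∈ hp n ↔ ω ∈ saws n ∧ InH n ω := by
  classical
  exact Finset.mem_filter

/-- Membership in `arches`. [cite: Beaton2014RotatedHoneycomb, §3.1 (arXiv v3 p. 11: c^+_n(m), C^+_n(y), unfolded walks; proof of Proposition 7 pp. 12–14)] -/
theorem mem_arches : ω ∈ arches n ↔ ω ∈ hp n ∧ ω n 0 = 0 := by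
  classical
  exact Finset.mem_filter

/-- Membership in `wb`. [cite: Beaton2014RotatedHoneycomb, §3.1 (arXiv v3 p. 11: c^+_n(m), C^+_n(y), unfolded walks; proof of Proposition 7 pp. 12–14)] -/
theorem mem_wb : ω ∈ wb n ↔ ω ∈ arches n ∧ IsWB n ω := by
  classical
  exact Finset.mem_filter

/-- `hp n ⊆ saws n`. [cite: Beaton2014RotatedHoneycomb, §3.1 (arXiv v3 p. 11: c^+_n(m), C^+_n(y), unfolded walks; proof of Proposition 7 pp. 12–14)] -/
theorem hp_subset : hp n ⊆ saws n := fun _ h => (mem_hp.1 h).1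
/-- `arches n ⊆ hp n`. [cite: Beaton2014RotatedHoneycomb, §3.1 (arXiv v3 p. 11: c^+_n(m), C^+_n(y), unfolded walks; proof of Proposition 7 pp. 12–14)] -/
theorem arches_subset : arches n ⊆ hp n := fun _ h => (mem_arches.1 h).1
/-- `wb n ⊆ arches n`. [cite: Beaton2014RotatedHoneycomb, §3.1 (arXiv v3 p. 11: c^+_n(m), C^+_n(y), unfolded walks; proof of Proposition 7 pp. 12–14)] -/
theorem wb_subset : wb n ⊆ arches n := fun _ h => (mem_wb.1 h).1

/-- **`C^w_n(y) := Σ_{ω ∈ hp n} y^{visits}`** — Beaton's `C⁺_{n+1}(y)` read in the brick wall (`n` steps = `n+1` vertices).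
[cite: Beaton2014RotatedHoneycomb, §3.1 (arXiv v3 p. 11: C^+_n(y) = Σ_m c^+_n(m) y^m)] -/
def Cw (n : ℕ) (y : ℝ) : ℝ := ∑ ω ∈ hp n, y ^ visits n ω

/-- **`A_n(y)`**: weighted arches. [cite: HammersleyTorrieWhittington1982, §2] -/
def Aw (n : ℕ) (y : ℝ) : ℝ := ∑ ω ∈ arches n, y ^ visits n ω

/-- **`B^w_n(y)`**: weighted armchair wall bridges. [cite: HammersleyTorrieWhittington1982, §2; Beaton2014RotatedHoneycomb, §3.1 (arXiv v3 p. 12: U^+_n(y))] -/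
def WB (n : ℕ) (y : ℝ) : ℝ := ∑ ω ∈ wb n, y ^ visits n ω

/-- `C^w_n(y) ≥ 0`. [cite: Beaton2014RotatedHoneycomb, §3.1 (arXiv v3 p. 11: c^+_n(m), C^+_n(y), unfolded walks; proof of Proposition 7 pp. 12–14)] -/
theorem Cw_nonneg (n : ℕ) (hy : 0 ≤ y) : 0 ≤ Cw n y := Finset.sum_nonneg fun _ _ => pow_nonneg hy _
/-- `A_n(y) ≥ 0`. [cite: Beaton2014RotatedHoneycomb, §3.1 (arXiv v3 p. 11: c^+_n(m), C^+_n(y), unfolded walks; proof of Proposition 7 pp. 12–14)] -/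
theorem Aw_nonneg (n : ℕ) (hy : 0 ≤ y) : 0 ≤ Aw n y := Finset.sum_nonneg fun _ _ => pow_nonneg hy _
/-- `B^w_n(y) ≥ 0`. [cite: Beaton2014RotatedHoneycomb, §3.1 (arXiv v3 p. 11: c^+_n(m), C^+_n(y), unfolded walks; proof of Proposition 7 pp. 12–14)] -/
theorem WB_nonneg (n : ℕ) (hy : 0 ≤ y) : 0 ≤ WB n y := Finset.sum_nonneg fun _ _ => pow_nonneg hy _

/-- `B^w_n ≤ A_n`. [cite: Beaton2014RotatedHoneycomb, §3.1 (arXiv v3 p. 11: c^+_n(m), C^+_n(y), unfolded walks; proof of Proposition 7 pp. 12–14)] -/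
theorem WB_le_Aw (n : ℕ) (hy : 0 ≤ y) : WB n y ≤ Aw n y :=
  Finset.sum_le_sum_of_subset_of_nonneg wb_subset fun _ _ _ => pow_nonneg hy _
/-- `A_n ≤ C^w_n`. [cite: Beaton2014RotatedHoneycomb, §3.1 (arXiv v3 p. 11: c^+_n(m), C^+_n(y), unfolded walks; proof of Proposition 7 pp. 12–14)] -/
theorem Aw_le_Cw (n : ℕ) (hy : 0 ≤ y) : Aw n y ≤ Cw n y :=
  Finset.sum_le_sum_of_subset_of_nonneg arches_subset fun _ _ _ => pow_nonneg hy _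

/-- The start is a visit: `1 ≤ visits n ω` for walks from `0`. [cite: Beaton2014RotatedHoneycomb, §3.1 (arXiv v3 p. 11: "occupying m vertices in the surface")] -/
theorem one_le_visits (h0 : ω 0 = 0) (n : ℕ) : 1 ≤ visits n ω := by
  have h : visits 0 ω = 1 := by rw [visits_zero, if_pos (by rw [h0]; rfl)]
  calc 1 = visits 0 ω := h.symm
    _ ≤ visits n ω := visits_mono (Nat.zero_le n) ω

/-! ### The surface zig-zag: `B^w_{4k+1}(y) > 0` -/

/-- The period-4 zig-zag along the armchair wall: `(0,0), (0,1), (1,1), (1,2), (0,2), (0,3), …` —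
`X_i = [i mod 4 ∈ {2,3}]`, `Y_i = ⌊(i+1)/2⌋` ("walks which step along the surface").
[cite: Beaton2014RotatedHoneycomb, §3.1 (arXiv v3 p. 14: "the lower bound μ(y) ≥ √y is obtained by considering walks which step along the surface")] -/
def zz (i : ℕ) : Site 2 := fun j => if j = 0 then (if i % 4 = 2 ∨ i % 4 = 3 then 1 else 0) else (((i + 1) / 2 : ℕ) : ℤ)

/-- Coordinates of the zig-zag. [cite: Beaton2014RotatedHoneycomb, §3.1 (arXiv v3 p. 11: c^+_n(m), C^+_n(y), unfolded walks; proof of Proposition 7 pp. 12–14)] -/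
theorem zz_apply_zero (i : ℕ) : zz i 0 = if i % 4 = 2 ∨ i % 4 = 3 then 1 else 0 := by simp [zz]
/-- Coordinates of the zig-zag. [cite: Beaton2014RotatedHoneycomb, §3.1 (arXiv v3 p. 11: c^+_n(m), C^+_n(y), unfolded walks; proof of Proposition 7 pp. 12–14)] -/
theorem zz_apply_one (i : ℕ) : zz i 1 = (((i + 1) / 2 : ℕ) : ℤ) := by simp [zz]

/-- The wall coordinate of the zig-zag is `0` at times `≡ 0, 1 (mod 4)` and `1` at times `≡ 2, 3 (mod 4)`. [cite: Beaton2014RotatedHoneycomb, §3.1 (arXiv v3 p. 11: c^+_n(m), C^+_n(y), unfolded walks; proof of Proposition 7 pp. 12–14)] -/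
theorem zz_zero_cases (i : ℕ) : (zz i 0 = 0 ∧ (i % 4 = 0 ∨ i % 4 = 1)) ∨ (zz i 0 = 1 ∧ (i % 4 = 2 ∨ i % 4 = 3)) := by
  rw [zz_apply_zero]
  split_ifs with h
  · exact Or.inr ⟨rfl, h⟩
  · exact Or.inl ⟨rfl, by omega⟩

/-- A horizontal step is a brick-wall bond. [cite: EntingJensen2009, §7.4.2, Fig. 7.10] -/
theorem adj_of_horiz {x z : Site 2} (h1 : z 1 = x 1) (h0 : z 0 = x 0 + 1 ∨ x 0 = z 0 + 1) : brickWallGraph.Adj x z := by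
  rw [brickWallGraph_adj_coord]; exact Or.inl ⟨h0, h1⟩

/-- An upward step from a site of even type is a brick-wall bond. [cite: EntingJensen2009, §7.4.2, Fig. 7.10] -/
theorem adj_of_up {x z : Site 2} (h0 : z 0 = x 0) (h1 : z 1 = x 1 + 1) (he : (x 0 + x 1) % 2 = 0) :
    brickWallGraph.Adj x z := by
  rw [brickWallGraph_adj_coord]; exact Or.inr ⟨h0, Or.inl ⟨h1, he⟩⟩

/-- A downward step to a site of even type is a brick-wall bond. [cite: EntingJensen2009, §7.4.2, Fig. 7.10] -/
theorem adj_of_down {x z : Site 2} (h0 : z 0 = x 0) (h1 : x 1 = z 1 + 1) (he : (z 0 + z 1) % 2 = 0) :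
    brickWallGraph.Adj x z := by
  rw [brickWallGraph_adj_coord]; exact Or.inr ⟨h0, Or.inr ⟨h1, he⟩⟩

/-- Consecutive zig-zag vertices are brick-wall neighbours. [cite: EntingJensen2009, §7.4.2, Fig. 7.10] -/
theorem zz_adj (i : ℕ) : brickWallGraph.Adj (zz i) (zz (i + 1)) := by
  rcases zz_zero_cases i with ⟨a0, ha⟩ | ⟨a0, ha⟩ <;> rcases zz_zero_cases (i + 1) with ⟨b0, hb⟩ | ⟨b0, hb⟩
  · -- `i ≡ 0`: up the dimer on the wall
    have hi : i % 4 = 0 := by omega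
    refine adj_of_up (by rw [a0, b0]) ?_ ?_
    · rw [zz_apply_one, zz_apply_one]
      have : (i + 1 + 1) / 2 = (i + 1) / 2 + 1 := by omega
      rw [this]; push_cast; ring
    · rw [a0, zz_apply_one, zero_add]
      have : (i + 1) / 2 % 2 = 0 := by omega
      exact_mod_cast this
  · -- `i ≡ 1`: horizontal, away from the wall
    have hi : i % 4 = 1 := by omega
    refine adj_of_horiz ?_ (Or.inl (by rw [a0, b0]; norm_num))
    rw [zz_apply_one, zz_apply_one]
    have : (i + 1 + 1) / 2 = (i + 1) / 2 := by omega
    rw [this]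
  · -- `i ≡ 3`: horizontal, back to the wall
    have hi : i % 4 = 3 := by omega
    refine adj_of_horiz ?_ (Or.inr (by rw [a0, b0]; norm_num))
    rw [zz_apply_one, zz_apply_one]
    have : (i + 1 + 1) / 2 = (i + 1) / 2 := by omega
    rw [this]
  · -- `i ≡ 2`: up the dimer in column `1`
    have hi : i % 4 = 2 := by omega
    refine adj_of_up (by rw [a0, b0]) ?_ ?_
    · rw [zz_apply_one, zz_apply_one]
      have : (i + 1 + 1) / 2 = (i + 1) / 2 + 1 := by omega
      rw [this]; push_cast; ring
    · rw [a0, zz_apply_one]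
      have : (1 + (i + 1) / 2) % 2 = 0 := by omega
      exact_mod_cast this

/-- The `m`-step zig-zag walk (frozen after time `m`). [cite: Beaton2014RotatedHoneycomb, §3.1 (arXiv v3 p. 14)] -/
def zzWalk (m : ℕ) : ℕ → Site 2 := fun i => zz (min i m)

/-- The zig-zag walk is a self-avoiding brick-wall walk from `0` in the half-plane. [cite: Beaton2014RotatedHoneycomb, §3.1 (arXiv v3 p. 14)] -/
theorem zzWalk_mem_hp (m : ℕ) : zzWalk m ∈ hp m := by
  refine mem_hp.2 ⟨mem_saws_iff.2 ⟨?_, fun i hi => ?_, fun i hi => ?_, ?_⟩, fun i _ => ?_⟩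
  · rw [site_two_eq_iff]; simp [zzWalk, zz]
  · simp [zzWalk, min_eq_right hi]
  · simp only [zzWalk, min_eq_left hi.le, min_eq_left (Nat.succ_le_of_lt hi)]
    exact zz_adj i
  · intro i hi j hj hij
    simp only [Set.mem_setOf_eq] at hi hj
    rw [site_two_eq_iff] at hij
    simp only [zzWalk, min_eq_left hi, min_eq_left hj, zz_apply_one, Nat.cast_inj] at hij
    obtain ⟨h0, h1⟩ := hij
    rcases zz_zero_cases i with ⟨a0, ha⟩ | ⟨a0, ha⟩ <;> rcases zz_zero_cases j with ⟨b0, hb⟩ | ⟨b0, hb⟩ <;>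
      (rw [a0, b0] at h0; omega)
  · simp only [zzWalk]
    rcases zz_zero_cases (min i m) with ⟨a0, -⟩ | ⟨a0, -⟩
    · rw [a0]
    · rw [a0]; norm_num

/-- The zig-zag of length `4k+1` is an armchair wall bridge (it ends at `(0, 2k+1)`). [cite: Beaton2014RotatedHoneycomb, §3.1 (arXiv v3 p. 14)] -/
theorem zzWalk_mem_wb (k : ℕ) : zzWalk (4 * k + 1) ∈ wb (4 * k + 1) := by
  refine mem_wb.2 ⟨mem_arches.2 ⟨zzWalk_mem_hp _, ?_⟩, ?_, fun i hi1 hi => ?_⟩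
  · simp only [zzWalk, min_self]
    rcases zz_zero_cases (4 * k + 1) with ⟨a0, -⟩ | ⟨-, ha⟩
    · exact a0
    · omega
  · simp only [zzWalk, min_self, zz_apply_one]; push_cast; omega
  · simp only [zzWalk, min_self, min_eq_left hi.le, zz_apply_one]
    constructor
    · have : 1 ≤ (i + 1) / 2 := by omega
      exact_mod_cast this
    · have : (i + 1) / 2 < (4 * k + 1 + 1) / 2 := by omega
      exact_mod_cast this

/-- **`B^w_{4k+1}(y) > 0`** for `y > 0`. [cite: Beaton2014RotatedHoneycomb, §3.1 (arXiv v3 p. 14: walks which step along the surface)] -/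
theorem WB_pos (hy : 0 < y) (k : ℕ) : 0 < WB (4 * k + 1) y := by
  rw [WB]
  exact lt_of_lt_of_le (pow_pos hy _)
    (Finset.single_le_sum (fun _ _ => pow_nonneg hy.le _) (zzWalk_mem_wb k))


/-! ### Anatomy of armchair wall bridges -/

/-- Unpacking a wall bridge: SAW data, half-plane, end on the wall, strictness. [cite: Beaton2014RotatedHoneycomb, §3.1 (arXiv v3 p. 11: c^+_n(m), C^+_n(y), unfolded walks; proof of Proposition 7 pp. 12–14)] -/
theorem wb_anatomy (hω : ω ∈ wb n) :
    ω ∈ saws n ∧ InH n ω ∧ ω n 0 = 0 ∧ 0 < ω n 1 ∧ (∀ i, 1 ≤ i → i < n → 0 < ω i 1 ∧ ω i 1 < ω n 1) := by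
  obtain ⟨ha, hpos, hint⟩ := mem_wb.1 hω
  obtain ⟨hh, hend⟩ := mem_arches.1 ha
  obtain ⟨hs, hH⟩ := mem_hp.1 hh
  exact ⟨hs, hH, hend, hpos, hint⟩

/-- Level bounds of a wall bridge: `0 ≤ Y_i ≤ Y_n` for all `i ≤ n`, with `Y_i = Y_n` only at `i = n`. [cite: Beaton2014RotatedHoneycomb, §3.1 (arXiv v3 p. 11: c^+_n(m), C^+_n(y), unfolded walks; proof of Proposition 7 pp. 12–14)] -/
theorem wb_level_le (hω : ω ∈ wb n) {i : ℕ} (hi : i ≤ n) : 0 ≤ ω i 1 ∧ ω i 1 ≤ ω n 1 ∧ (ω i 1 = ω n 1 → i = n) := by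
  obtain ⟨hs, -, -, hpos, hint⟩ := wb_anatomy hω
  have h0 : ω 0 = 0 := (mem_saws_iff.1 hs).1
  rcases Nat.eq_zero_or_pos i with rfl | hi0
  · rw [h0]; refine ⟨le_rfl, hpos.le, fun h => ?_⟩
    have : (0 : Site 2) 1 = 0 := rfl
    rw [this] at h; exact absurd h hpos.ne
  · rcases hi.lt_or_eq with hlt | rfl
    · have := hint i hi0 hlt
      exact ⟨this.1.le, this.2.le, fun h => absurd h this.2.ne⟩
    · exact ⟨hpos.le, le_rfl, fun _ => rfl⟩

/-- A wall bridge has `n ≥ 1`. [cite: Beaton2014RotatedHoneycomb, §3.1 (arXiv v3 p. 11: c^+_n(m), C^+_n(y), unfolded walks; proof of Proposition 7 pp. 12–14)] -/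
theorem one_le_of_mem_wb (hω : ω ∈ wb n) : 1 ≤ n := by
  obtain ⟨hs, -, -, hpos, -⟩ := wb_anatomy hω
  by_contra h
  have hn : n = 0 := by omega
  subst hn
  rw [(mem_saws_iff.1 hs).1] at hpos
  exact lt_irrefl _ hpos

/-- **The end of a wall bridge is the UPPER vertex of a wall dimer: `Y_n` is odd** (the last step is the dimer step `(0, Y_n - 1) → (0, Y_n)`).
[cite: EntingJensen2009, §7.4.2, Fig. 7.10 (brickwork form); Beaton2014RotatedHoneycomb, §2 (Fig. 1: the armchair surface)] -/
theorem wb_end_odd (hω : ω ∈ wb n) : ω n 1 % 2 = 1 := by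
  obtain ⟨hs, hH, hend, hpos, hint⟩ := wb_anatomy hω
  have hn := one_le_of_mem_wb hω
  obtain ⟨h0, -, hbw, -⟩ := mem_saws_iff.1 hs
  have hstep := step_cases (hbw (n - 1) (by omega))
  rw [show n - 1 + 1 = n by omega] at hstep
  have hX := hH (n - 1) (by omega)
  rcases Nat.lt_or_ge 1 n with h1n | h1n
  · have hlt := (hint (n - 1) (by omega) (by omega)).2
    rcases hstep with ⟨h1, -⟩ | ⟨hx0, hy1, he⟩ | ⟨-, hy1, -⟩
    · omega
    · rw [← hx0, hend] at he; omega
    · omega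
  · have hn1 : n = 1 := le_antisymm h1n hn
    subst hn1
    simp only [Nat.sub_self, h0] at hstep
    have z0 : (0 : Site 2) 0 = 0 := rfl
    have z1 : (0 : Site 2) 1 = 0 := rfl
    rw [z0, z1] at hstep
    omega

/-! ### Concatenation of armchair wall bridges through the connector `(1, Y) → (1, Y+1)`: `B^w_{n₁} B^w_{n₂} ≤ B^w_{n₁+3+n₂}` -/

/-- The site `(a, b)`. [cite: EntingJensen2009, §7.4.2, Fig. 7.10 (brickwork form of the honeycomb lattice)] -/
def pt (a b : ℤ) : Site 2 := fun j => if j = 0 then a else b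

/-- Coordinates of `pt`. [cite: EntingJensen2009, §7.4.2, Fig. 7.10 (brickwork form of the honeycomb lattice)] -/
@[simp] theorem pt_apply_zero (a b : ℤ) : pt a b 0 = a := rfl
/-- Coordinates of `pt`. [cite: EntingJensen2009, §7.4.2, Fig. 7.10 (brickwork form of the honeycomb lattice)] -/
@[simp] theorem pt_apply_one (a b : ℤ) : pt a b 1 = b := rfl

/-- The relative connector `0 → (1,0) → (1,1) → (0,1)` (a `ℤ²` walk; read from the end `(0, Y)` of a wall bridge, `Y` odd, its steps are
brick-wall bonds). [cite: Beaton2014RotatedHoneycomb, §3.1 (arXiv v3 p. 12: "the addition of one or two mid-edges at the point of concatenation may be necessary")] -/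
def conn : ℕ → Site 2 := fun i => if i = 0 then 0 else if i = 1 then pt 1 0 else if i = 2 then pt 1 1 else pt 0 1

/-- Values of the connector. [cite: EntingJensen2009, §7.4.2, Fig. 7.10 (brickwork form of the honeycomb lattice)] -/
theorem conn_zero : conn 0 = 0 := rfl
/-- Values of the connector. [cite: EntingJensen2009, §7.4.2, Fig. 7.10 (brickwork form of the honeycomb lattice)] -/
theorem conn_one : conn 1 = pt 1 0 := rfl
/-- Values of the connector. [cite: EntingJensen2009, §7.4.2, Fig. 7.10 (brickwork form of the honeycomb lattice)] -/
theorem conn_two : conn 2 = pt 1 1 := rfl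
/-- Values of the connector. [cite: EntingJensen2009, §7.4.2, Fig. 7.10 (brickwork form of the honeycomb lattice)] -/
theorem conn_of_three_le {i : ℕ} (hi : 3 ≤ i) : conn i = pt 0 1 := by
  unfold conn; rw [if_neg (by omega), if_neg (by omega), if_neg (by omega)]

/-- **The tail piece**: the connector followed by (the translate by `(0,1)` of) `υ`. [cite: Beaton2014RotatedHoneycomb, §3.1 (arXiv v3 p. 12)] -/
def tailPiece (υ : ℕ → Site 2) : ℕ → Site 2 := Zd.concatWalk 3 conn υ

/-- **Junction concatenation** of two armchair wall bridges: `ω`, then `E → E + (1,0) → E + (1,1) → E + (0,1)`, then `υ` shifted by `E + (0,1)`.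
[cite: HammersleyTorrieWhittington1982, §2 (concatenation of unfolded surface walks); Beaton2014RotatedHoneycomb, §3.1 (arXiv v3 p. 12)] -/
def jcat (n₁ : ℕ) (ω υ : ℕ → Site 2) : ℕ → Site 2 := Zd.concatWalk n₁ ω (tailPiece υ)

/-- Values of the tail piece on the connector. [cite: EntingJensen2009, §7.4.2, Fig. 7.10 (brickwork form of the honeycomb lattice)] -/
theorem tailPiece_apply_of_le (υ : ℕ → Site 2) {i : ℕ} (hi : i ≤ 3) : tailPiece υ i = conn i :=
  Zd.concatWalk_apply_of_le _ _ hi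

/-- Values of the tail piece after the connector. [cite: EntingJensen2009, §7.4.2, Fig. 7.10 (brickwork form of the honeycomb lattice)] -/
theorem tailPiece_apply_add {υ : ℕ → Site 2} (h0 : υ 0 = 0) (j : ℕ) : tailPiece υ (3 + j) = pt 0 1 + υ j := by
  rw [tailPiece, Zd.concatWalk_apply_add _ _ h0 j, conn_of_three_le le_rfl]

/-- The tail piece determines `υ` (for walks from `0`). [cite: EntingJensen2009, §7.4.2, Fig. 7.10 (brickwork form of the honeycomb lattice)] -/
theorem tailPiece_injective {υ υ' : ℕ → Site 2} (h0 : υ 0 = 0) (h0' : υ' 0 = 0) (h : tailPiece υ = tailPiece υ') : υ = υ' := by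
  funext j
  have e := congrFun h (3 + j)
  rw [tailPiece_apply_add h0, tailPiece_apply_add h0'] at e
  exact add_left_cancel e

/-- Values of the tail piece after the connector, shifted index. [cite: EntingJensen2009, §7.4.2, Fig. 7.10 (brickwork form of the honeycomb lattice)] -/
theorem tailPiece_apply_of_ge {υ : ℕ → Site 2} (h0 : υ 0 = 0) {i : ℕ} (hi : 3 ≤ i) : tailPiece υ i = pt 0 1 + υ (i - 3) := by
  rw [show i = 3 + (i - 3) by omega, tailPiece_apply_add h0]; simp

/-- Coordinates of the connector part of the tail piece: `(X, Y) = (0,0), (1,0), (1,1), (0,1)` at times `0,1,2,3`. [cite: EntingJensen2009, §7.4.2, Fig. 7.10 (brickwork form of the honeycomb lattice)] -/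
theorem tailPiece_conn_vals (υ : ℕ → Site 2) (h0 : υ 0 = 0) :
    (tailPiece υ 0 0 = 0 ∧ tailPiece υ 0 1 = 0) ∧ (tailPiece υ 1 0 = 1 ∧ tailPiece υ 1 1 = 0) ∧
      (tailPiece υ 2 0 = 1 ∧ tailPiece υ 2 1 = 1) ∧ (tailPiece υ 3 0 = 0 ∧ tailPiece υ 3 1 = 1) := by
  rw [tailPiece_apply_of_le υ (by norm_num : 0 ≤ 3), tailPiece_apply_of_le υ (by norm_num : 1 ≤ 3),
    tailPiece_apply_of_le υ (by norm_num : 2 ≤ 3), tailPiece_apply_of_ge h0 le_rfl, Nat.sub_self, h0, add_zero,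
    conn_zero, conn_one, conn_two]
  exact ⟨⟨rfl, rfl⟩, ⟨rfl, rfl⟩, ⟨rfl, rfl⟩, ⟨rfl, rfl⟩⟩

/-- The tail piece of a wall bridge is a `ℤ²`-SAW (levels separate the connector from the shifted bridge). [cite: EntingJensen2009, §7.4.2, Fig. 7.10 (brickwork form of the honeycomb lattice)] -/
theorem tailPiece_mem_zd {n₂ : ℕ} {υ : ℕ → Site 2} (hυ : υ ∈ wb n₂) : tailPiece υ ∈ Zd.saws 2 (3 + n₂) := by
  obtain ⟨hs, -, -, hpos, hint⟩ := wb_anatomy hυ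
  obtain ⟨h0, hend, hadj, hinj⟩ := Zd.mem_saws.1 (saws_subset _ hs)
  obtain ⟨⟨v00, v01⟩, ⟨v10, v11⟩, ⟨v20, v21⟩, ⟨v30, v31⟩⟩ := tailPiece_conn_vals υ h0
  have hlev : ∀ j, 1 ≤ j → 1 ≤ υ j 1 := by
    intro j hj
    rcases Nat.lt_or_ge j n₂ with hlt | hge
    · exact (hint j hj hlt).1
    · rw [hend j hge]; exact hpos
  refine Zd.mem_saws.2 ⟨?_, fun i hi => ?_, fun i hi => ?_, ?_⟩
  · rw [tailPiece_apply_of_le υ (Nat.zero_le 3), conn_zero]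
  · rw [tailPiece_apply_of_ge h0 (by omega), tailPiece_apply_of_ge h0 (by omega), hend (i - 3) (by omega),
      show 3 + n₂ - 3 = n₂ by omega]
  · rcases Nat.lt_or_ge i 3 with h3 | h3
    · rw [Zd.zdGraph_adj_iff_sub]
      have hc : i = 0 ∨ i = 1 ∨ i = 2 := by omega
      rcases hc with rfl | rfl | rfl
      · refine ⟨0, Or.inl ?_⟩; funext j; fin_cases j
        · simp only [Pi.sub_apply, Fin.zero_eta, Pi.single_eq_same]; rw [v10, v00]; norm_num
        · simp only [Pi.sub_apply, Fin.mk_one, Pi.single_eq_of_ne (one_ne_zero : (1 : Fin 2) ≠ 0)]; rw [v11, v01]; norm_num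
      · refine ⟨1, Or.inl ?_⟩; funext j; fin_cases j
        · simp only [Pi.sub_apply, Fin.zero_eta, Pi.single_eq_of_ne (zero_ne_one : (0 : Fin 2) ≠ 1)]; rw [v20, v10]; norm_num
        · simp only [Pi.sub_apply, Fin.mk_one, Pi.single_eq_same]; rw [v21, v11]; norm_num
      · refine ⟨0, Or.inr ?_⟩; funext j; fin_cases j
        · simp only [Pi.sub_apply, Fin.zero_eta, Pi.single_eq_same]; rw [v20, v30]; norm_num
        · simp only [Pi.sub_apply, Fin.mk_one, Pi.single_eq_of_ne (one_ne_zero : (1 : Fin 2) ≠ 0)]; rw [v21, v31]; norm_num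
    · rw [tailPiece_apply_of_ge h0 h3, tailPiece_apply_of_ge h0 (by omega), show i + 1 - 3 = i - 3 + 1 by omega,
        add_comm (pt 0 1) (υ (i - 3)), add_comm (pt 0 1) (υ (i - 3 + 1)), Zd.zdGraph_adj_add_right]
      exact hadj (i - 3) (by omega)
  · intro i hi j hj hij
    simp only [Set.mem_setOf_eq] at hi hj
    -- levels: times `≤ 2` have `Y ≤ 1` with `(X,Y)` pairwise distinct; times `k ≥ 3` have `Y = 1 + υ_{k-3} 1 ≥ 1`, `= 1` iff `k = 3`.
    have key : ∀ k ≤ 3 + n₂, ∀ l ≤ 3 + n₂, k < l → tailPiece υ k ≠ tailPiece υ l := by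
      intro k hk l hl hkl e
      rw [site_two_eq_iff] at e
      obtain ⟨e0, e1⟩ := e
      rcases Nat.lt_or_ge l 3 with hl3 | hl3
      · have hc : (k = 0 ∧ l = 1) ∨ (k = 0 ∧ l = 2) ∨ (k = 1 ∧ l = 2) := by omega
        rcases hc with ⟨rfl, rfl⟩ | ⟨rfl, rfl⟩ | ⟨rfl, rfl⟩
        · rw [v00, v10] at e0; norm_num at e0
        · rw [v00, v20] at e0; norm_num at e0
        · rw [v11, v21] at e1; norm_num at e1
      · rw [tailPiece_apply_of_ge h0 hl3, Pi.add_apply, pt_apply_one] at e1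
        rcases Nat.lt_or_ge k 3 with hk3 | hk3
        · -- `k ≤ 2 < 3 ≤ l`: level of `k` is `≤ 1`, level of `l` is `1 + υ_{l-3} ≥ 1`, equal only if `l = 3`, then compare with `(0,1)`
          rcases Nat.lt_or_ge 3 l with hl4 | hl4
          · have := hlev (l - 3) (by omega)
            have hc : k = 0 ∨ k = 1 ∨ k = 2 := by omega
            rcases hc with rfl | rfl | rfl
            · rw [v01] at e1; omega
            · rw [v11] at e1; omega
            · rw [v21] at e1
              rw [tailPiece_apply_of_ge h0 hl3, Pi.add_apply, pt_apply_zero, v20] at e0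
              -- X: 1 = 0 + υ_{l-3} 0 and Y: 1 = 1 + υ 1 ⇒ υ (l-3) = (1, 0), level 0 — contradiction with hlev
              omega
          · have hl' : l = 3 := by omega
            subst hl'
            have hc : k = 0 ∨ k = 1 ∨ k = 2 := by omega
            rw [Nat.sub_self, h0] at e1
            rw [tailPiece_apply_of_ge h0 le_rfl, Nat.sub_self, h0, Pi.add_apply, pt_apply_zero] at e0
            rcases hc with rfl | rfl | rfl
            · rw [v01] at e1; norm_num at e1
            · rw [v10] at e0; norm_num at e0
            · rw [v20] at e0; norm_num at e0
        · rw [tailPiece_apply_of_ge h0 hk3, Pi.add_apply, pt_apply_one] at e1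
          rw [tailPiece_apply_of_ge h0 hk3, tailPiece_apply_of_ge h0 hl3, Pi.add_apply, Pi.add_apply, pt_apply_zero] at e0
          have heq : υ (k - 3) = υ (l - 3) := by
            rw [site_two_eq_iff]; constructor <;> omega
          have := hinj (show k - 3 ∈ {i | i ≤ n₂} by simp; omega) (show l - 3 ∈ {i | i ≤ n₂} by simp; omega) heq
          omega
    rcases lt_trichotomy i j with h | h | h
    · exact absurd hij (key i hi j hj h)
    · exact h
    · exact absurd hij.symm (key j hj i hi h)


/-- Levels along the tail piece: `0, 0, 1` on the connector and `1 + Y^υ_{j}` from time `3` on. [cite: EntingJensen2009, §7.4.2, Fig. 7.10 (brickwork form of the honeycomb lattice)] -/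
theorem tailPiece_level {n₂ : ℕ} {υ : ℕ → Site 2} (hυ : υ ∈ wb n₂) {j : ℕ} (hj1 : 1 ≤ j) :
    (j = 1 ∧ tailPiece υ j 0 = 1 ∧ tailPiece υ j 1 = 0) ∨ 1 ≤ tailPiece υ j 1 := by
  obtain ⟨hs, -, -, hpos, hint⟩ := wb_anatomy hυ
  obtain ⟨h0, hend, -, -⟩ := Zd.mem_saws.1 (saws_subset _ hs)
  obtain ⟨-, ⟨v10, v11⟩, ⟨-, v21⟩, -⟩ := tailPiece_conn_vals υ h0
  rcases Nat.lt_or_ge j 3 with h3 | h3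
  · have hc : j = 1 ∨ j = 2 := by omega
    rcases hc with rfl | rfl
    · exact Or.inl ⟨rfl, v10, v11⟩
    · right; rw [v21]
  · right
    rw [tailPiece_apply_of_ge h0 h3, Pi.add_apply, pt_apply_one]
    have : 0 ≤ υ (j - 3) 1 := by
      rcases Nat.eq_zero_or_pos (j - 3) with hz | hz
      · rw [hz, h0]; exact le_rfl
      · rcases Nat.lt_or_ge (j - 3) n₂ with hlt | hge
        · exact (hint _ hz hlt).1.le
        · rw [hend _ hge]; exact hpos.le
    omega

/-- **The junction concatenation of two armchair wall bridges is an armchair wall bridge, with `visits = v₁ + v₂`.**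
[cite: HammersleyTorrieWhittington1982, §2 (concatenation of unfolded surface walks); Beaton2014RotatedHoneycomb, §3.1 (arXiv v3 p. 12)] -/
theorem jcat_spec {n₁ n₂ : ℕ} {υ : ℕ → Site 2} (hω : ω ∈ wb n₁) (hυ : υ ∈ wb n₂) :
    jcat n₁ ω υ ∈ wb (n₁ + (3 + n₂)) ∧ visits (n₁ + (3 + n₂)) (jcat n₁ ω υ) = visits n₁ ω + visits n₂ υ := by
  obtain ⟨hωs, hωH, hωend, hωpos, hωint⟩ := wb_anatomy hω
  obtain ⟨hυs, hυH, hυend, hυpos, hυint⟩ := wb_anatomy hυ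
  obtain ⟨hω0, hωfr, hωbw, -⟩ := mem_saws_iff.1 hωs
  obtain ⟨hυ0, hυfr, hυbw, -⟩ := mem_saws_iff.1 hυs
  have hodd := wb_end_odd hω
  have hT := tailPiece_mem_zd hυ
  have hT0 : tailPiece υ 0 = 0 := (Zd.mem_saws.1 hT).1
  obtain ⟨⟨v00, v01⟩, ⟨v10, v11⟩, ⟨v20, v21⟩, ⟨v30, v31⟩⟩ := tailPiece_conn_vals υ hυ0
  set M₁ := ω n₁ 1 with hM₁
  set N := n₁ + (3 + n₂) with hN
  -- values
  have hv1 : ∀ i ≤ n₁, jcat n₁ ω υ i = ω i := fun i hi => Zd.concatWalk_apply_of_le _ _ hi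
  have hv2 : ∀ j, jcat n₁ ω υ (n₁ + j) = ω n₁ + tailPiece υ j := fun j => Zd.concatWalk_apply_add _ _ hT0 j
  have hv2' : ∀ j, jcat n₁ ω υ (n₁ + j) 0 = tailPiece υ j 0 ∧ jcat n₁ ω υ (n₁ + j) 1 = M₁ + tailPiece υ j 1 := fun j => by
    rw [hv2 j, Pi.add_apply, Pi.add_apply, hωend, zero_add]; exact ⟨rfl, rfl⟩
  have hv3 : ∀ j, jcat n₁ ω υ (n₁ + (3 + j)) 0 = υ j 0 ∧ jcat n₁ ω υ (n₁ + (3 + j)) 1 = M₁ + 1 + υ j 1 := fun j => by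
    obtain ⟨e0, e1⟩ := hv2' (3 + j)
    rw [tailPiece_apply_add hυ0, Pi.add_apply, pt_apply_zero, zero_add] at e0
    rw [tailPiece_apply_add hυ0, Pi.add_apply, pt_apply_one] at e1
    exact ⟨e0, by rw [e1]; ring⟩
  have hυlev : ∀ j ≤ n₂, 0 ≤ υ j 1 ∧ υ j 1 ≤ υ n₂ 1 := fun j hj => ⟨(wb_level_le hυ hj).1, (wb_level_le hυ hj).2.1⟩
  -- membership in `Zd.saws`
  have hsep : ∀ i ≤ n₁, ∀ j, 1 ≤ j → j ≤ 3 + n₂ → ω i ≠ ω n₁ + tailPiece υ j := by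
    intro i hi j hj1 hj e
    have e0 := congrFun e 0
    have e1 := congrFun e 1
    rw [Pi.add_apply, hωend, zero_add] at e0
    rw [Pi.add_apply] at e1
    obtain ⟨-, hle, heq⟩ := wb_level_le hω hi
    rcases tailPiece_level hυ hj1 with ⟨rfl, t0, t1⟩ | ht
    · rw [t1, add_zero] at e1
      have := heq e1; subst this
      rw [hωend, t0] at e0; norm_num at e0
    · rw [← hM₁] at e1 hle; omega
  have hzd : jcat n₁ ω υ ∈ Zd.saws 2 N := Zd.concatWalk_mem_saws (saws_subset _ hωs) hT hsep
  -- brick-wall steps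
  have hbw : IsBW N (jcat n₁ ω υ) := by
    intro i hi
    rcases Nat.lt_or_ge i n₁ with h1 | h1
    · rw [hv1 i h1.le, hv1 (i + 1) (by omega)]; exact hωbw i h1
    · obtain ⟨j, rfl⟩ : ∃ j, i = n₁ + j := ⟨i - n₁, by omega⟩
      rw [show n₁ + j + 1 = n₁ + (j + 1) by omega]
      obtain ⟨a0, a1⟩ := hv2' j
      obtain ⟨b0, b1⟩ := hv2' (j + 1)
      rcases Nat.lt_or_ge j 3 with hj3 | hj3
      · have hc : j = 0 ∨ j = 1 ∨ j = 2 := by omega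
        rcases hc with rfl | rfl | rfl
        · rw [v00] at a0; rw [v01] at a1; rw [v10] at b0; rw [v11] at b1
          exact adj_of_horiz (by rw [a1, b1]) (Or.inl (by rw [a0, b0]; norm_num))
        · rw [v10] at a0; rw [v11] at a1; rw [v20] at b0; rw [v21] at b1
          exact adj_of_up (by rw [a0, b0]) (by rw [a1, b1]; ring) (by rw [a0, a1]; omega)
        · rw [v20] at a0; rw [v21] at a1; rw [v30] at b0; rw [v31] at b1
          exact adj_of_horiz (by rw [a1, b1]) (Or.inr (by rw [a0, b0]; norm_num))
      · obtain ⟨k, rfl⟩ : ∃ k, j = 3 + k := ⟨j - 3, by omega⟩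
        obtain ⟨c0, c1⟩ := hv3 k
        obtain ⟨d0, d1⟩ := hv3 (k + 1)
        rw [show 3 + k + 1 = 3 + (k + 1) by omega]
        have e1 : jcat n₁ ω υ (n₁ + (3 + k)) = shiftY (M₁ + 1) (υ k) := by
          rw [site_two_eq_iff, shiftY_apply_zero, shiftY_apply_one, c0, c1]; exact ⟨rfl, by ring⟩
        have e2 : jcat n₁ ω υ (n₁ + (3 + (k + 1))) = shiftY (M₁ + 1) (υ (k + 1)) := by
          rw [site_two_eq_iff, shiftY_apply_zero, shiftY_apply_one, d0, d1]; exact ⟨rfl, by ring⟩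
        rw [e1, e2, adj_shiftY_iff (by omega)]
        exact hυbw k (by omega)
  have hmem : jcat n₁ ω υ ∈ saws N := mem_saws.2 ⟨hzd, hbw⟩
  -- levels of all times
  have hlev : ∀ i ≤ N, (i ≤ n₁ ∧ jcat n₁ ω υ i 1 = ω i 1) ∨ (i = n₁ + 1 ∧ jcat n₁ ω υ i 1 = M₁) ∨
      (i = n₁ + 2 ∧ jcat n₁ ω υ i 1 = M₁ + 1) ∨ (∃ k ≤ n₂, i = n₁ + (3 + k) ∧ jcat n₁ ω υ i 1 = M₁ + 1 + υ k 1) := by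
    intro i hi
    rcases Nat.lt_or_ge n₁ i with h1 | h1
    · obtain ⟨j, rfl⟩ : ∃ j, i = n₁ + j := ⟨i - n₁, by omega⟩
      rcases Nat.lt_or_ge j 3 with hj3 | hj3
      · have hc : j = 1 ∨ j = 2 := by omega
        rcases hc with rfl | rfl
        · right; left; refine ⟨rfl, ?_⟩; rw [(hv2' 1).2, v11, add_zero]
        · right; right; left; refine ⟨rfl, ?_⟩; rw [(hv2' 2).2, v21]
      · right; right; right
        refine ⟨j - 3, by omega, by omega, ?_⟩
        rw [show n₁ + j = n₁ + (3 + (j - 3)) by omega, (hv3 (j - 3)).2]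
    · left; exact ⟨h1, by rw [hv1 i h1]⟩
  have hNlev : jcat n₁ ω υ N 1 = M₁ + 1 + υ n₂ 1 := (hv3 n₂).2
  refine ⟨mem_wb.2 ⟨mem_arches.2 ⟨mem_hp.2 ⟨hmem, fun i hi => ?_⟩, ?_⟩, ?_, fun i hi1 hi => ?_⟩, ?_⟩
  · -- half-plane
    rcases Nat.lt_or_ge n₁ i with h1 | h1
    · obtain ⟨j, rfl⟩ : ∃ j, i = n₁ + j := ⟨i - n₁, by omega⟩
      rw [(hv2' j).1]
      rcases Nat.lt_or_ge j 3 with hj3 | hj3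
      · have hc : j = 0 ∨ j = 1 ∨ j = 2 := by omega
        rcases hc with rfl | rfl | rfl
        · rw [v00]
        · rw [v10]; norm_num
        · rw [v20]; norm_num
      · rw [tailPiece_apply_of_ge hυ0 hj3, Pi.add_apply, pt_apply_zero, zero_add]
        exact hυH (j - 3) (by omega)
    · rw [hv1 i h1]; exact hωH i h1
  · -- ends on the wall
    rw [hN, (hv3 n₂).1, hυend]
  · -- positive end level
    rw [hNlev]; have := (hυlev n₂ le_rfl).1; omega
  · -- strictness
    rw [hNlev]
    have hυn : 0 ≤ υ n₂ 1 := (hυlev n₂ le_rfl).1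
    rcases hlev i hi.le with ⟨h1, e⟩ | ⟨rfl, e⟩ | ⟨rfl, e⟩ | ⟨k, hk, rfl, e⟩
    · rw [e]
      obtain ⟨hge, hle, -⟩ := wb_level_le hω h1
      have hposi : 0 < ω i 1 := by
        rcases h1.lt_or_eq with hlt | rfl
        · exact (hωint i hi1 hlt).1
        · exact hωpos
      constructor <;> omega
    · rw [e]; constructor <;> omega
    · rw [e]; constructor <;> omega
    · rw [e]
      have hk' : k < n₂ := by omega
      have hku : υ k 1 < υ n₂ 1 := by
        rcases Nat.eq_zero_or_pos k with rfl | hk0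
        · rw [hυ0]; exact hυpos
        · exact (hυint k hk0 hk').2
      have := (hυlev k hk).1
      constructor <;> omega
  · -- visits
    have hA := visits_add (a := n₁) (b := 3 + n₂) (ζ := jcat n₁ ω υ) (ξ := tailPiece υ) fun j _ _ => (hv2' j).1
    have hB := visits_add (a := 3) (b := n₂) (ζ := tailPiece υ) (ξ := υ) fun j _ _ => by
      rw [tailPiece_apply_add hυ0, Pi.add_apply, pt_apply_zero, zero_add]
    have h3 : visits 3 (tailPiece υ) = 2 := by
      rw [show (3 : ℕ) = 0 + 1 + 1 + 1 from rfl, visits_succ, visits_succ, visits_succ, visits_zero]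
      simp only [show (0 : ℕ) + 1 = 1 from rfl, show (1 : ℕ) + 1 = 2 from rfl, show (2 : ℕ) + 1 = 3 from rfl]
      rw [v00, v10, v20, v30]; norm_num
    have hx0 : tailPiece υ 0 0 = 0 := v00
    have hu0 : υ 0 0 = 0 := by rw [hυ0]; rfl
    rw [if_pos hx0] at hA
    rw [if_pos hu0, h3] at hB
    have hC : visits n₁ (jcat n₁ ω υ) = visits n₁ ω := visits_congr fun i hi => by rw [hv1 i hi]
    rw [← hN] at hA
    omega

/-- **`B^w_{n₁}(y) · B^w_{n₂}(y) ≤ B^w_{n₁+3+n₂}(y)`** (junction concatenation is injective and adds no visit).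
[cite: HammersleyTorrieWhittington1982, §2 (supermultiplicativity of unfolded surface walks); MadrasSlade1993, §1.2, (1.2.15)] -/
theorem mul_WB_le (n₁ n₂ : ℕ) (hy : 0 ≤ y) : WB n₁ y * WB n₂ y ≤ WB (n₁ + (3 + n₂)) y := by
  classical
  have hinj : Set.InjOn (fun p : (ℕ → Site 2) × (ℕ → Site 2) => jcat n₁ p.1 p.2) ↑(wb n₁ ×ˢ wb n₂) := by
    rintro ⟨ω, υ⟩ hp ⟨ω', υ'⟩ hp' h
    rw [Finset.mem_coe, Finset.mem_product] at hp hp'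
    dsimp only at h
    have hωs := (wb_anatomy hp.1).1
    have hω's := (wb_anatomy hp'.1).1
    have hυs := (wb_anatomy hp.2).1
    have hυ's := (wb_anatomy hp'.2).1
    obtain ⟨h1, h2⟩ := Zd.concatWalk_injective_pieces (saws_subset _ hωs) (tailPiece_mem_zd hp.2)
      (saws_subset _ hω's) (tailPiece_mem_zd hp'.2) h
    have h3 := tailPiece_injective (mem_saws_iff.1 hυs).1 (mem_saws_iff.1 hυ's).1 h2
    simp only [Prod.mk.injEq]
    exact ⟨h1, h3⟩
  calc WB n₁ y * WB n₂ y
      = ∑ ω ∈ wb n₁, ∑ υ ∈ wb n₂, y ^ visits n₁ ω * y ^ visits n₂ υ := by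
        rw [WB, WB, Finset.sum_mul_sum]
    _ = ∑ p ∈ wb n₁ ×ˢ wb n₂, y ^ visits (n₁ + (3 + n₂)) (jcat n₁ p.1 p.2) := by
        rw [Finset.sum_product]
        refine Finset.sum_congr rfl fun ω hω => Finset.sum_congr rfl fun υ hυ => ?_
        dsimp only
        rw [(jcat_spec hω hυ).2, pow_add]
    _ = ∑ ζ ∈ (wb n₁ ×ˢ wb n₂).image (fun p => jcat n₁ p.1 p.2), y ^ visits (n₁ + (3 + n₂)) ζ :=
        (Finset.sum_image (f := fun ζ => y ^ visits (n₁ + (3 + n₂)) ζ) hinj).symm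
    _ ≤ WB (n₁ + (3 + n₂)) y := by
        refine Finset.sum_le_sum_of_subset_of_nonneg (fun ζ hζ => ?_) fun _ _ _ => pow_nonneg hy _
        obtain ⟨p, hp, rfl⟩ := Finset.mem_image.1 hζ
        rw [Finset.mem_product] at hp
        exact (jcat_spec hp.1 hp.2).1


/-! ### Parity: wall bridges have odd length; `B^w_n(y)² ≤ B^w_{2n+3}(y)` -/

/-- Wall bridges have odd length (`X_n + Y_n ≡ n` and `X_n = 0`, `Y_n` odd). [cite: EntingJensen2009, §7.4.2, Fig. 7.10] -/
theorem odd_of_mem_wb (hω : ω ∈ wb n) : n % 2 = 1 := by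
  obtain ⟨hs, -, hend, -, -⟩ := wb_anatomy hω
  have h1 := parity_apply hs le_rfl
  have h2 := wb_end_odd hω
  rw [hend, zero_add] at h1
  omega

/-- `B^w_n(y) = 0` for even `n`. [cite: Beaton2014RotatedHoneycomb, §3.1 (arXiv v3 p. 11: c^+_n(m), C^+_n(y), unfolded walks; proof of Proposition 7 pp. 12–14)] -/
theorem WB_eq_zero_of_even (hn : n % 2 = 0) (y : ℝ) : WB n y = 0 := by
  rw [WB]
  refine Finset.sum_eq_zero fun ω hω => ?_
  have := odd_of_mem_wb hω
  omega

/-- **`B^w_n(y)² ≤ B^w_{2n+3}(y)`** (concatenate a wall bridge with itself; note `2n+3 ≡ 1 (mod 4)` for odd `n`). [cite: MadrasSlade1993, §1.2, (1.2.15)] -/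
theorem WB_sq_le (n : ℕ) (hy : 0 ≤ y) : WB n y ^ 2 ≤ WB (2 * n + 3) y := by
  rw [sq, show 2 * n + 3 = n + (3 + n) by omega]
  exact mul_WB_le n n hy

/-! ### Appending a run away from the wall: `B^w_m(y) ≤ C^w_{m+j}(y)` -/

/-- A wall bridge followed by the horizontal run `(1, Y_m), …, (j, Y_m)` is a half-plane walk from the wall with the same visits.
[cite: Beaton2014RotatedHoneycomb, §3.1 (arXiv v3 p. 14: "we obviously have U^+_n(y) ≤ C^+_n(y)")] -/
theorem concat_straight_mem_hp {m : ℕ} (hω : ω ∈ wb m) (j : ℕ) :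
    Zd.concatWalk m ω (Zd.straightWalk 2 j) ∈ hp (m + j) ∧
      visits (m + j) (Zd.concatWalk m ω (Zd.straightWalk 2 j)) = visits m ω := by
  obtain ⟨hs, hH, hend, -, -⟩ := wb_anatomy hω
  obtain ⟨-, -, hbw, -⟩ := mem_saws_iff.1 hs
  have hst0 : Zd.straightWalk 2 j 0 = 0 := (Zd.mem_saws.1 (Zd.straightWalk_mem_saws 2 j)).1
  have hsv0 : ∀ i, Zd.straightWalk 2 j i 0 = ((min i j : ℕ) : ℤ) := fun i => by simp [Zd.straightWalk]
  have hsv1 : ∀ i, Zd.straightWalk 2 j i 1 = 0 := fun i => by simp [Zd.straightWalk]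
  have hv1 : ∀ i ≤ m, Zd.concatWalk m ω (Zd.straightWalk 2 j) i = ω i := fun i hi => Zd.concatWalk_apply_of_le _ _ hi
  have hv2 : ∀ i, Zd.concatWalk m ω (Zd.straightWalk 2 j) (m + i) 0 = ((min i j : ℕ) : ℤ) ∧
      Zd.concatWalk m ω (Zd.straightWalk 2 j) (m + i) 1 = ω m 1 := fun i => by
    rw [Zd.concatWalk_apply_add _ _ hst0, Pi.add_apply, Pi.add_apply, hend, hsv0, hsv1, zero_add, add_zero]
    exact ⟨rfl, rfl⟩
  have hsep : ∀ i ≤ m, ∀ k, 1 ≤ k → k ≤ j → ω i ≠ ω m + Zd.straightWalk 2 j k := by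
    intro i hi k hk1 hk e
    have e0 := congrFun e 0
    have e1 := congrFun e 1
    rw [Pi.add_apply, hend, hsv0, zero_add, min_eq_left hk] at e0
    rw [Pi.add_apply, hsv1, add_zero] at e1
    have := (wb_level_le hω hi).2.2 e1
    subst this
    rw [hend] at e0
    have : (k : ℤ) = 0 := by exact_mod_cast e0.symm
    omega
  have hzd := Zd.concatWalk_mem_saws (saws_subset _ hs) (Zd.straightWalk_mem_saws 2 j) hsep
  have hbw' : IsBW (m + j) (Zd.concatWalk m ω (Zd.straightWalk 2 j)) := by
    intro i hi
    rcases Nat.lt_or_ge i m with h1 | h1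
    · rw [hv1 i h1.le, hv1 (i + 1) (by omega)]; exact hbw i h1
    · obtain ⟨k, rfl⟩ : ∃ k, i = m + k := ⟨i - m, by omega⟩
      rw [show m + k + 1 = m + (k + 1) by omega]
      obtain ⟨a0, a1⟩ := hv2 k
      obtain ⟨b0, b1⟩ := hv2 (k + 1)
      refine adj_of_horiz (by rw [a1, b1]) (Or.inl ?_)
      rw [a0, b0, min_eq_left (by omega : k ≤ j), min_eq_left (by omega : k + 1 ≤ j)]; push_cast; ring
  refine ⟨mem_hp.2 ⟨mem_saws.2 ⟨hzd, hbw'⟩, fun i hi => ?_⟩, ?_⟩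
  · rcases Nat.lt_or_ge m i with h1 | h1
    · obtain ⟨k, rfl⟩ : ∃ k, i = m + k := ⟨i - m, by omega⟩
      rw [(hv2 k).1]; exact_mod_cast Nat.zero_le _
    · rw [hv1 i h1]; exact hH i h1
  · rw [visits_add_eq_left (k := m) (b := j) fun k hk1 _ => by
      rw [(hv2 k).1]; exact_mod_cast (show min k j ≠ 0 by omega : min k j ≠ 0)]
    exact visits_congr fun i hi => by rw [hv1 i hi]

/-- **`B^w_m(y) ≤ C^w_{m+j}(y)`** for every `j` (`y ≥ 0`). [cite: Beaton2014RotatedHoneycomb, §3.1 (arXiv v3 p. 14: U^+_n(y) ≤ C^+_n(y))] -/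
theorem WB_le_Cw_add (m j : ℕ) (hy : 0 ≤ y) : WB m y ≤ Cw (m + j) y := by
  classical
  have hinj : Set.InjOn (fun ω : ℕ → Site 2 => Zd.concatWalk m ω (Zd.straightWalk 2 j)) ↑(wb m) := by
    intro ω hω ω' hω' h
    exact (Zd.concatWalk_injective_pieces (saws_subset _ (wb_anatomy hω).1) (Zd.straightWalk_mem_saws 2 j)
      (saws_subset _ (wb_anatomy hω').1) (Zd.straightWalk_mem_saws 2 j) h).1
  calc WB m y = ∑ ω ∈ wb m, y ^ visits (m + j) (Zd.concatWalk m ω (Zd.straightWalk 2 j)) :=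
        Finset.sum_congr rfl fun ω hω => by rw [(concat_straight_mem_hp hω j).2]
    _ = ∑ ζ ∈ (wb m).image (fun ω => Zd.concatWalk m ω (Zd.straightWalk 2 j)), y ^ visits (m + j) ζ :=
        (Finset.sum_image (f := fun ζ => y ^ visits (m + j) ζ) hinj).symm
    _ ≤ Cw (m + j) y := by
        refine Finset.sum_le_sum_of_subset_of_nonneg (fun ζ hζ => ?_) fun _ _ _ => pow_nonneg hy _
        obtain ⟨ω, hω, rfl⟩ := Finset.mem_image.1 hζ
        exact (concat_straight_mem_hp hω j).1

/-! ### Fekete: the armchair wall-bridge growth rate `β_rot(y)` -/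

/-- The shifted sequence `d_k = B^w_{4k-3}(y)` (`d_0 = 1`): supermultiplicative by `mul_WB_le` (`(4p-3)+3+(4q-3) = 4(p+q)-3`).
[cite: MadrasSlade1993, §1.2, Lemma 1.2.2 and (1.2.16)] -/
def wseq (y : ℝ) (k : ℕ) : ℝ := if k = 0 then 1 else WB (4 * k - 3) y

/-- `d_k > 0` (the zig-zag of length `4(k-1)+1`). [cite: MadrasSlade1993, §1.2, Lemma 1.2.2 and (1.2.15)–(1.2.17)] -/
theorem wseq_pos (hy : 0 < y) (k : ℕ) : 0 < wseq y k := by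
  unfold wseq
  split_ifs with h
  · exact one_pos
  · rw [show 4 * k - 3 = 4 * (k - 1) + 1 by omega]; exact WB_pos hy (k - 1)

/-- Supermultiplicativity: `d_p d_q ≤ d_{p+q}`. [cite: MadrasSlade1993, §1.2, (1.2.15)–(1.2.16)] -/
theorem wseq_mul_le (hy : 0 ≤ y) (p q : ℕ) : wseq y p * wseq y q ≤ wseq y (p + q) := by
  unfold wseq
  rcases Nat.eq_zero_or_pos p with rfl | hp
  · simp
  rcases Nat.eq_zero_or_pos q with rfl | hq
  · simp
  rw [if_neg (by omega), if_neg (by omega), if_neg (by omega), show 4 * (p + q) - 3 = (4 * p - 3) + (3 + (4 * q - 3)) by omega]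
  exact mul_WB_le _ _ hy

/-- A priori bound: `B^w_m(y) ≤ #(saws m) · max(1,y)^{m+1}`. [cite: MadrasSlade1993, §1.2, Lemma 1.2.2 and (1.2.15)–(1.2.17)] -/
theorem WB_le_card_mul_pow (m : ℕ) (hy : 0 ≤ y) : WB m y ≤ #(saws m) * max 1 y ^ (m + 1) := by
  calc WB m y ≤ ∑ ω ∈ wb m, max 1 y ^ (m + 1) := Finset.sum_le_sum fun ω _ => by
        calc y ^ visits m ω ≤ max 1 y ^ visits m ω := pow_le_pow_left₀ hy (le_max_right _ _) _
          _ ≤ max 1 y ^ (m + 1) := pow_le_pow_right₀ (le_max_left _ _) (visits_le m ω)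
    _ = #(wb m) * max 1 y ^ (m + 1) := by rw [Finset.sum_const, nsmul_eq_mul]
    _ ≤ #(saws m) * max 1 y ^ (m + 1) := by
        gcongr
        exact (wb_subset.trans arches_subset).trans hp_subset

/-- A priori exponential bound `B^w_m(y) ≤ μ max(1,y) · (e⁶ μ max(1,y))^m`. [cite: MadrasSlade1993, §1.2 (p. 11); HammersleyWelsh1962, Theorem] -/
theorem WB_le_apriori (m : ℕ) (hy : 0 ≤ y) :
    WB m y ≤ hexConnectiveConstant * max 1 y * (Real.exp 6 * hexConnectiveConstant * max 1 y) ^ m := by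
  have hμ := hexConnectiveConstant_pos
  have h1 := WB_le_card_mul_pow m hy
  have hmm : (m : ℝ) ≤ (m : ℝ) ^ 2 := by
    rcases Nat.eq_zero_or_pos m with rfl | hm
    · simp
    · have : (1 : ℝ) ≤ m := by exact_mod_cast hm
      nlinarith
  have hs : Real.sqrt m ≤ m :=
    calc Real.sqrt m ≤ Real.sqrt ((m : ℝ) ^ 2) := Real.sqrt_le_sqrt hmm
      _ = m := Real.sqrt_sq (Nat.cast_nonneg m)
  have h2 : (#(saws m) : ℝ) ≤ hexConnectiveConstant * (Real.exp 6 * hexConnectiveConstant) ^ m := by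
    rw [card_saws]
    have h := hexSawCount_le_mu_mul_exp_mul_pow m
    have he : Real.exp (6 * Real.sqrt m) ≤ Real.exp 6 ^ m := by
      rw [← Real.exp_nat_mul]
      exact Real.exp_le_exp.2 (by nlinarith)
    calc (hexSawCount m : ℝ) ≤ hexConnectiveConstant * Real.exp (6 * Real.sqrt m) * hexConnectiveConstant ^ m := h
      _ ≤ hexConnectiveConstant * Real.exp 6 ^ m * hexConnectiveConstant ^ m :=
          mul_le_mul_of_nonneg_right (mul_le_mul_of_nonneg_left he hμ.le) (pow_nonneg hμ.le _)
      _ = hexConnectiveConstant * (Real.exp 6 * hexConnectiveConstant) ^ m := by ring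
  have hmax : (0 : ℝ) ≤ max 1 y := zero_le_one.trans (le_max_left _ _)
  calc WB m y ≤ #(saws m) * max 1 y ^ (m + 1) := h1
    _ ≤ hexConnectiveConstant * (Real.exp 6 * hexConnectiveConstant) ^ m * max 1 y ^ (m + 1) :=
        mul_le_mul_of_nonneg_right h2 (pow_nonneg hmax _)
    _ = hexConnectiveConstant * max 1 y * (Real.exp 6 * hexConnectiveConstant * max 1 y) ^ m := by ring

/-- `d_k ≤ A · K^k` for `k ≥ 1`, with `K = (e⁶ μ max(1,y))⁴`. [cite: MadrasSlade1993, §1.2, Lemma 1.2.2 (boundedness hypothesis)] -/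
theorem wseq_le (hy : 0 < y) {k : ℕ} (hk : 1 ≤ k) :
    wseq y k ≤ (hexConnectiveConstant * max 1 y / (Real.exp 6 * hexConnectiveConstant * max 1 y) ^ 3) *
      ((Real.exp 6 * hexConnectiveConstant * max 1 y) ^ 4) ^ k := by
  set L := Real.exp 6 * hexConnectiveConstant * max 1 y
  have hμ := hexConnectiveConstant_pos
  have hL0 : 0 < L := mul_pos (mul_pos (Real.exp_pos 6) hμ) (lt_of_lt_of_le one_pos (le_max_left 1 y))
  have hL1 : L ^ 3 ≠ 0 := pow_ne_zero _ hL0.ne'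
  rw [wseq, if_neg (by omega : k ≠ 0)]
  have h := WB_le_apriori (4 * k - 3) hy.le
  have hLk : (L ^ 4) ^ k = L ^ (4 * k - 3) * L ^ 3 := by
    rw [← pow_mul, ← pow_add]; congr 1; omega
  rw [hLk]
  calc WB (4 * k - 3) y ≤ hexConnectiveConstant * max 1 y * L ^ (4 * k - 3) := h
    _ = hexConnectiveConstant * max 1 y / L ^ 3 * (L ^ (4 * k - 3) * L ^ 3) := by
        rw [div_mul_eq_mul_div, eq_div_iff hL1]; ring

/-- `u_k = -log d_k`. [cite: MadrasSlade1993, §1.2, Lemma 1.2.2] -/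
def armU (y : ℝ) (k : ℕ) : ℝ := -Real.log (wseq y k)

/-- `ℓ(y) = lim_k u_k / k = inf_{k ≥ 1} u_k / k` (Fekete). [cite: MadrasSlade1993, §1.2, Lemma 1.2.2] -/
def armLogLim (y : ℝ) : ℝ := sInf ((fun k : ℕ => armU y k / k) '' Set.Ici 1)

/-- **The armchair wall-bridge growth rate `β_rot(y) = exp(-ℓ(y)/4) = lim_k (B^w_{4k-3}(y))^{1/(4k)}`** — the rate of Beaton's
unfolded walks `U^+_n(y)` along the rotated (armchair) surface.
[cite: Beaton2014RotatedHoneycomb, §3.1 (arXiv v3 p. 12: "μ(y) = lim U^+_n(y)^{1/n} exists"); HammersleyTorrieWhittington1982, §2] -/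
def armRate (y : ℝ) : ℝ := Real.exp (-(armLogLim y) / 4)

/-- `β_rot(y) > 0`. [cite: MadrasSlade1993, §1.2, Lemma 1.2.2 and (1.2.15)–(1.2.17)] -/
theorem armRate_pos (y : ℝ) : 0 < armRate y := Real.exp_pos _

/-- `u` is subadditive. [cite: MadrasSlade1993, §1.2, (1.2.16)] -/
theorem armU_subadditive (hy : 0 < y) : Subadditive (armU y) := by
  intro p q
  have hp := wseq_pos hy p
  have hq := wseq_pos hy q
  have h := wseq_mul_le hy.le p q
  have hlog := Real.log_le_log (mul_pos hp hq) h
  rw [Real.log_mul hp.ne' hq.ne'] at hlog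
  simp only [armU]
  linarith

/-- `u_k / k` is bounded below. [cite: MadrasSlade1993, §1.2, Lemma 1.2.2] -/
theorem armU_bddBelow (hy : 0 < y) : BddBelow (Set.range fun k : ℕ => armU y k / k) := by
  set L := Real.exp 6 * hexConnectiveConstant * max 1 y
  set A := hexConnectiveConstant * max 1 y / L ^ 3
  set K := L ^ 4
  have hμ := hexConnectiveConstant_pos
  have hm1 : (0 : ℝ) < max 1 y := lt_of_lt_of_le one_pos (le_max_left 1 y)
  have hL0 : 0 < L := mul_pos (mul_pos (Real.exp_pos 6) hμ) hm1
  have hA : 0 < A := div_pos (mul_pos hμ hm1) (pow_pos hL0 3)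
  have hK : 0 < K := pow_pos hL0 4
  refine ⟨-(max (Real.log A) 0 + max (Real.log K) 0), ?_⟩
  rintro _ ⟨k, rfl⟩
  rcases Nat.eq_zero_or_pos k with rfl | hk
  · simp only [Nat.cast_zero, div_zero]
    linarith [le_max_right (Real.log A) 0, le_max_right (Real.log K) 0]
  · have hk' : (0 : ℝ) < k := by exact_mod_cast hk
    have hk1 : (1 : ℝ) ≤ k := by exact_mod_cast hk
    have h1 : wseq y k ≤ A * K ^ k := wseq_le hy hk
    have h2 := Real.log_le_log (wseq_pos hy k) h1
    rw [Real.log_mul hA.ne' (pow_pos hK k).ne', Real.log_pow] at h2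
    rw [le_div_iff₀ hk']
    simp only [armU]
    have h3 : Real.log A ≤ max (Real.log A) 0 * k := by
      nlinarith [le_max_left (Real.log A) 0, le_max_right (Real.log A) 0]
    have h4 : (k : ℝ) * Real.log K ≤ k * max (Real.log K) 0 :=
      mul_le_mul_of_nonneg_left (le_max_left _ _) hk'.le
    linarith

/-- The Fekete limit is `armLogLim`. [cite: MadrasSlade1993, §1.2, Lemma 1.2.2] -/
theorem subadditive_lim_eq (hy : 0 < y) : (armU_subadditive hy).lim = armLogLim y := by
  rw [armLogLim, Subadditive.lim]

/-- **`u_k / k → ℓ(y)`** (Fekete). [cite: MadrasSlade1993, §1.2, Lemma 1.2.2] -/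
theorem tendsto_armU_div (hy : 0 < y) : Tendsto (fun k : ℕ => armU y k / k) atTop (𝓝 (armLogLim y)) := by
  rw [← subadditive_lim_eq hy]
  exact (armU_subadditive hy).tendsto_lim (armU_bddBelow hy)

/-- **`ℓ(y) ≤ u_k / k`** for `k ≥ 1` (the limit is the infimum). [cite: MadrasSlade1993, §1.2, Lemma 1.2.2, (1.2.6)] -/
theorem armLogLim_le (hy : 0 < y) {k : ℕ} (hk : k ≠ 0) : armLogLim y ≤ armU y k / k := by
  rw [← subadditive_lim_eq hy]
  exact (armU_subadditive hy).lim_le_div (armU_bddBelow hy) hk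

/-- **`d_k ≤ (β⁴)^k`** for every `k`. [cite: MadrasSlade1993, §1.2, (1.2.17)] -/
theorem wseq_le_pow (hy : 0 < y) (k : ℕ) : wseq y k ≤ (armRate y ^ 4) ^ k := by
  rcases Nat.eq_zero_or_pos k with rfl | hk
  · simp [wseq]
  have h1 := armLogLim_le hy hk.ne'
  have hk' : (0 : ℝ) < k := by exact_mod_cast hk
  rw [le_div_iff₀ hk', armU] at h1
  have h2 : Real.log (wseq y k) ≤ k * (-(armLogLim y)) := by linarith
  calc wseq y k = Real.exp (Real.log (wseq y k)) := (Real.exp_log (wseq_pos hy k)).symm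
    _ ≤ Real.exp (k * (-(armLogLim y))) := Real.exp_le_exp.2 h2
    _ = (armRate y ^ 4) ^ k := by
        rw [armRate, ← Real.exp_nat_mul, ← Real.exp_nat_mul]; congr 1; push_cast; ring

/-- **`B^w_{4k+1}(y) ≤ β_rot(y)^{4k+4}`**. [cite: MadrasSlade1993, §1.2, (1.2.17)] -/
theorem WB_le_pow_mod (hy : 0 < y) (k : ℕ) : WB (4 * k + 1) y ≤ armRate y ^ (4 * k + 4) := by
  have h := wseq_le_pow hy (k + 1)
  rw [wseq, if_neg (by omega), show 4 * (k + 1) - 3 = 4 * k + 1 by omega, ← pow_mul,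
    show 4 * (k + 1) = 4 * k + 4 by ring] at h
  exact h

/-- **`B^w_n(y) ≤ β_rot(y)^{n+3}` for EVERY `n`** (odd `n`: square and use `2n+3 = 4·((n+1)/2)+1`; even `n`: `B^w_n = 0`).
[cite: MadrasSlade1993, §1.2, (1.2.17)] -/
theorem WB_le_pow (hy : 0 < y) (n : ℕ) : WB n y ≤ armRate y ^ (n + 3) := by
  have hβ := armRate_pos y
  rcases Nat.even_or_odd n with ⟨j, rfl⟩ | ⟨j, rfl⟩
  · rw [WB_eq_zero_of_even (by omega)]; exact pow_nonneg hβ.le _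
  · have h1 := WB_sq_le (2 * j + 1) hy.le
    have h2 := WB_le_pow_mod hy (j + 1)
    rw [show 4 * (j + 1) + 1 = 2 * (2 * j + 1) + 3 by ring] at h2
    have h3 : WB (2 * j + 1) y ^ 2 ≤ (armRate y ^ (2 * j + 1 + 3)) ^ 2 := by
      calc WB (2 * j + 1) y ^ 2 ≤ armRate y ^ (4 * (j + 1) + 4) := h1.trans h2
        _ = (armRate y ^ (2 * j + 1 + 3)) ^ 2 := by rw [← pow_mul]; congr 1; ring
    exact (pow_le_pow_iff_left₀ (WB_nonneg _ hy.le) (pow_nonneg hβ.le _) two_ne_zero).1 h3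

/-- Eventually `r^{4k} ≤ d_k` for every rate `0 < r < β_rot(y)`. [cite: MadrasSlade1993, §1.2, Lemma 1.2.2 (the limit is attained)] -/
theorem eventually_pow_le_wseq (hy : 0 < y) {r : ℝ} (hr0 : 0 < r) (hr : r < armRate y) :
    ∀ᶠ k : ℕ in atTop, r ^ (4 * k) ≤ wseq y k := by
  have hlog : armLogLim y < -4 * Real.log r := by
    have h1 : Real.log r < Real.log (armRate y) := Real.log_lt_log hr0 hr
    rw [armRate, Real.log_exp] at h1
    linarith
  have hev := (tendsto_order.1 (tendsto_armU_div hy)).2 _ hlog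
  filter_upwards [hev, eventually_gt_atTop 0] with k hk hk0
  have hk' : (0 : ℝ) < k := by exact_mod_cast hk0
  rw [div_lt_iff₀ hk', armU] at hk
  rw [← Real.log_le_log_iff (pow_pos hr0 _) (wseq_pos hy k), Real.log_pow]
  push_cast
  nlinarith

/-- **`liminf_n C^w_n(y)^{1/n} ≥ β_rot(y)`, rate form with a constant**: for `0 < r < β_rot(y)` and any `c`, eventually `c rⁿ ≤ C^w_n(y)`
(via `B^w_{4k-3} ≤ C^w_n` for `4k - 3 ≤ n`). [cite: Beaton2014RotatedHoneycomb, §3.1 (arXiv v3 p. 14: "μ(y) ≤ liminf C^+_n(y)^{1/n}")] -/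
theorem eventually_mul_pow_le_Cw (hy : 0 < y) (c : ℝ) {r : ℝ} (hr0 : 0 < r) (hr : r < armRate y) :
    ∀ᶠ n : ℕ in atTop, c * r ^ n ≤ Cw n y := by
  set τ := (r + armRate y) / 2 with hτ
  have hτr : r < τ := by rw [hτ]; linarith
  have hτβ : τ < armRate y := by rw [hτ]; linarith
  have hτ0 : 0 < τ := hr0.trans hτr
  have h1 := eventually_pow_le_wseq hy hτ0 hτβ
  have hρ : 1 < τ / r := (one_lt_div hr0).2 hτr
  -- `c r^{4k-3+j} ≤ τ^{4k}` eventually in `k`, uniformly in `j ≤ 3`: from `(τ/r)^{4k} → ∞`.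
  have h2 : ∀ᶠ k : ℕ in atTop, ∀ j ≤ 3, c * r ^ (4 * k - 3 + j) ≤ τ ^ (4 * k) := by
    set D := max c 0 * max 1 r⁻¹ ^ 3 with hD
    have ht := (tendsto_pow_atTop_atTop_of_one_lt hρ).eventually_ge_atTop D
    have ht4 : Tendsto (fun k : ℕ => 4 * k) atTop atTop := Filter.tendsto_id.const_mul_atTop' (by norm_num)
    filter_upwards [ht4.eventually ht, eventually_ge_atTop 1] with k hk hk1
    intro j hj
    have hrk : 0 < r ^ (4 * k) := pow_pos hr0 _
    have hm1 : 1 ≤ max 1 r⁻¹ := le_max_left _ _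
    have hpow : r ^ (4 * k - 3 + j) ≤ max 1 r⁻¹ ^ 3 * r ^ (4 * k) := by
      have e : r ^ (4 * k - 3 + j) = r ^ (4 * k) * r⁻¹ ^ (3 - j) := by
        have h3 : r ^ (4 * k) = r ^ (4 * k - 3 + j) * r ^ (3 - j) := by rw [← pow_add]; congr 1; omega
        rw [h3, mul_assoc, ← mul_pow, mul_inv_cancel₀ hr0.ne', one_pow, mul_one]
      rw [e, mul_comm]
      refine mul_le_mul_of_nonneg_right ?_ hrk.le
      calc r⁻¹ ^ (3 - j) ≤ max 1 r⁻¹ ^ (3 - j) := pow_le_pow_left₀ (inv_nonneg.2 hr0.le) (le_max_right _ _) _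
        _ ≤ max 1 r⁻¹ ^ 3 := pow_le_pow_right₀ hm1 (by omega)
    calc c * r ^ (4 * k - 3 + j) ≤ max c 0 * r ^ (4 * k - 3 + j) :=
          mul_le_mul_of_nonneg_right (le_max_left _ _) (pow_nonneg hr0.le _)
      _ ≤ max c 0 * (max 1 r⁻¹ ^ 3 * r ^ (4 * k)) := mul_le_mul_of_nonneg_left hpow (le_max_right _ _)
      _ = D * r ^ (4 * k) := by rw [hD]; ring
      _ ≤ (τ / r) ^ (4 * k) * r ^ (4 * k) := mul_le_mul_of_nonneg_right hk hrk.le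
      _ = τ ^ (4 * k) := by rw [div_pow, div_mul_cancel₀ _ hrk.ne']
  obtain ⟨K, hK⟩ := eventually_atTop.1 (h1.and h2)
  refine eventually_atTop.2 ⟨4 * max K 1, fun n hn => ?_⟩
  -- write `n = (4k - 3) + j` with `k = (n+3)/4`, `j ≤ 3`
  set k := (n + 3) / 4 with hk
  have hkK : K ≤ k := by omega
  have hk1 : 1 ≤ k := by omega
  obtain ⟨hw, hc⟩ := hK k hkK
  have hj : n = 4 * k - 3 + (n - (4 * k - 3)) := by omega
  have hj3 : n - (4 * k - 3) ≤ 3 := by omega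
  have hWB : wseq y k ≤ Cw n y := by
    rw [wseq, if_neg (by omega)]
    rw [hj]
    exact WB_le_Cw_add _ _ hy.le
  calc c * r ^ n = c * r ^ (4 * k - 3 + (n - (4 * k - 3))) := by rw [← hj]
    _ ≤ τ ^ (4 * k) := hc _ hj3
    _ ≤ wseq y k := hw
    _ ≤ Cw n y := hWB


/-! ### Splitting at the last wall visit: `C^w_n(y) ≤ Σ_k A_k(y) c_{n-k}(ℍ)` -/

/-- The last wall visit of `ω` in `[0, n]`. [cite: HammersleyTorrieWhittington1982, §2 (decomposition at the last surface contact)] -/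
def lastV (n : ℕ) (ω : ℕ → Site 2) : ℕ := Nat.findGreatest (fun i => ω i 0 = 0) n

/-- `lastV ≤ n`. [cite: HammersleyTorrieWhittington1982, §2 (unfolded walks; decomposition at the last surface contact)] -/
theorem lastV_le (n : ℕ) (ω : ℕ → Site 2) : lastV n ω ≤ n := Nat.findGreatest_le n

/-- The last visit is a visit (time `0` is one). [cite: HammersleyTorrieWhittington1982, §2 (unfolded walks; decomposition at the last surface contact)] -/
theorem lastV_spec (h0 : ω 0 = 0) : ω (lastV n ω) 0 = 0 := by
  have h : ω 0 0 = 0 := by rw [h0]; rfl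
  exact Nat.findGreatest_spec (P := fun i => ω i 0 = 0) (Nat.zero_le n) h

/-- No visit after the last one. [cite: HammersleyTorrieWhittington1982, §2 (unfolded walks; decomposition at the last surface contact)] -/
theorem not_visit_of_lastV_lt {i : ℕ} (h1 : lastV n ω < i) (h2 : i ≤ n) : ω i 0 ≠ 0 :=
  Nat.findGreatest_is_greatest h1 h2

/-- The prefix up to a wall visit is an arch with the same visits up to that time. [cite: MadrasSlade1993, §1.2, (1.2.3)] -/
theorem prefixWalk_mem_arches (hω : ω ∈ hp n) {k : ℕ} (hk : k ≤ n) (hX : ω k 0 = 0) :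
    Zd.prefixWalk k ω ∈ arches k ∧ visits k (Zd.prefixWalk k ω) = visits k ω := by
  obtain ⟨hωs, hH⟩ := mem_hp.1 hω
  obtain ⟨h0, -, hbw, -⟩ := mem_saws_iff.1 hωs
  have hv : ∀ i ≤ k, Zd.prefixWalk k ω i = ω i := fun i hi => by simp [Zd.prefixWalk, min_eq_left hi]
  refine ⟨mem_arches.2 ⟨mem_hp.2 ⟨mem_saws.2 ⟨Zd.prefixWalk_mem_saws (saws_subset _ hωs) hk, fun i hi => ?_⟩,
    fun i hi => ?_⟩, ?_⟩, visits_congr fun i hi => by rw [hv i hi]⟩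
  · rw [hv i hi.le, hv (i + 1) (by omega)]; exact hbw i (by omega)
  · rw [hv i hi]; exact hH i (by omega)
  · rw [hv k le_rfl]; exact hX

/-- The suffix after time `k`, read from `ω_k` with the parity twist, is a brick-wall SAW from `0`. [cite: MadrasSlade1993, §1.2, (1.2.3); EntingJensen2009, §7.4.2, Fig. 7.10] -/
theorem twist_suffixWalk_mem (hω : ω ∈ saws n) {k : ℕ} (hk : k ≤ n) :
    (fun i => twistAt (ω k) (Zd.suffixWalk k (n - k) ω i)) ∈ saws (n - k) := by
  obtain ⟨h0, -, hbw, -⟩ := mem_saws_iff.1 hω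
  have hsuf := Zd.suffixWalk_mem_saws (saws_subset _ hω) (show k + (n - k) ≤ n by omega)
  obtain ⟨hs0, hsfr, hsadj, hsinj⟩ := Zd.mem_saws.1 hsuf
  refine mem_saws.2 ⟨Zd.mem_saws.2 ⟨by simp only [hs0, twistAt_zero], fun i hi => by simp only [hsfr i hi],
    fun i hi => (zd_adj_twistAt_iff _ _ _).2 (hsadj i hi), fun i hi j hj hij => hsinj hi hj (twistAt_injective _ hij)⟩,
    fun i hi => ?_⟩
  have h1 : Zd.suffixWalk k (n - k) ω i = ω (k + i) - ω k := by simp [Zd.suffixWalk, min_eq_left hi.le]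
  have h2 : Zd.suffixWalk k (n - k) ω (i + 1) = ω (k + i + 1) - ω k := by
    simp [Zd.suffixWalk, min_eq_left (Nat.succ_le_of_lt hi), add_assoc]
  simp only [h1, h2]
  rw [adj_twistAt_sub_iff]
  exact hbw (k + i) (by omega)

open Classical in
/-- The walks with last visit at time `k` weigh at most `A_k(y) · c_{n-k}(ℍ)` (prefix / twisted-suffix injection).
[cite: HammersleyTorrieWhittington1982, §2; MadrasSlade1993, §1.2, (1.2.3)] -/
theorem sum_fibre_lastV_le (hy : 0 ≤ y) {k : ℕ} (hk : k ≤ n) :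
    ∑ ω ∈ (hp n).filter (fun ω => lastV n ω = k), y ^ visits n ω ≤ Aw k y * #(saws (n - k)) := by
  set F := (hp n).filter (fun ω => lastV n ω = k)
  set g : (ℕ → Site 2) → (ℕ → Site 2) × (ℕ → Site 2) :=
    fun ω => (Zd.prefixWalk k ω, fun i => twistAt (ω k) (Zd.suffixWalk k (n - k) ω i)) with hg
  have hF : ∀ ω ∈ F, ω ∈ hp n ∧ lastV n ω = k := fun ω hω => Finset.mem_filter.1 hω
  have hprops : ∀ ω ∈ F, visits n ω = visits k (Zd.prefixWalk k ω) ∧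
      Zd.prefixWalk k ω ∈ arches k ∧ (fun i => twistAt (ω k) (Zd.suffixWalk k (n - k) ω i)) ∈ saws (n - k) := by
    intro ω hω
    obtain ⟨hωh, hl⟩ := hF ω hω
    have hωs := hp_subset hωh
    obtain ⟨h0, -, -, -⟩ := mem_saws_iff.1 hωs
    have hX := lastV_spec (n := n) h0
    rw [hl] at hX
    obtain ⟨hpa, hpv⟩ := prefixWalk_mem_arches hωh hk hX
    refine ⟨?_, hpa, twist_suffixWalk_mem hωs hk⟩
    have e := visits_add_eq_left (k := k) (b := n - k) (ζ := ω)
      (fun j hj1 hjb => not_visit_of_lastV_lt (n := n) (ω := ω) (by omega) (by omega))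
    rw [Nat.add_sub_cancel' hk] at e
    rw [hpv, e]
  have hinj : Set.InjOn g ↑F := by
    intro ω hω ω' hω' h
    simp only [hg, Prod.mk.injEq] at h
    obtain ⟨h1, h2⟩ := h
    have hkk : ω k = ω' k := by simpa [Zd.prefixWalk] using congrFun h1 k
    have h3 : Zd.suffixWalk k (n - k) ω = Zd.suffixWalk k (n - k) ω' := by
      funext i
      have := congrFun h2 i
      rw [hkk] at this
      exact twistAt_injective _ this
    exact Zd.prefix_suffix_injOn hk (saws_subset _ (hp_subset (hF ω hω).1))
      (saws_subset _ (hp_subset (hF ω' hω').1)) (Prod.ext h1 h3)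
  calc ∑ ω ∈ F, y ^ visits n ω = ∑ ω ∈ F, y ^ visits k (g ω).1 :=
        Finset.sum_congr rfl fun ω hω => by rw [(hprops ω hω).1]
    _ = ∑ p ∈ F.image g, y ^ visits k p.1 := by rw [Finset.sum_image hinj]
    _ ≤ ∑ p ∈ arches k ×ˢ saws (n - k), y ^ visits k p.1 := by
        refine Finset.sum_le_sum_of_subset_of_nonneg (fun p hp' => ?_) fun _ _ _ => pow_nonneg hy _
        obtain ⟨ω, hω, rfl⟩ := Finset.mem_image.1 hp'
        exact Finset.mem_product.2 ⟨(hprops ω hω).2.1, (hprops ω hω).2.2⟩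
    _ = Aw k y * #(saws (n - k)) := by
        rw [Finset.sum_product, Aw, Finset.sum_mul]
        refine Finset.sum_congr rfl fun φ _ => ?_
        dsimp only
        rw [Finset.sum_const, nsmul_eq_mul, mul_comm]

open Classical in
/-- **`C^w_n(y) ≤ Σ_{k ≤ n} A_k(y) · c_{n-k}(ℍ)`** (`y ≥ 0`): split at the last wall visit.
[cite: HammersleyTorrieWhittington1982, §2; Beaton2014RotatedHoneycomb, §3.1, Proposition 7 (arXiv v3 p. 11)] -/
theorem Cw_le_sum (n : ℕ) (hy : 0 ≤ y) : Cw n y ≤ ∑ k ∈ range (n + 1), Aw k y * #(saws (n - k)) := by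
  have hf : ∀ ω ∈ hp n, lastV n ω ∈ range (n + 1) := fun ω _ =>
    Finset.mem_range.2 (Nat.lt_succ_of_le (lastV_le n ω))
  rw [Cw, ← Finset.sum_fiberwise_of_maps_to hf]
  exact Finset.sum_le_sum fun k hk => sum_fibre_lastV_le hy (Nat.le_of_lt_succ (Finset.mem_range.1 hk))

/-! ### The unfolding face and the upper rate `limsup C^w_n(y)^{1/n} ≤ max(β_rot(y), μ)` -/

/-- **Face «ARM-ARCH-BOUND» (Beaton's fixed-length unfolding along the armchair surface, in rate form)**: the weighted arches grow at most at
the wall-bridge rate — `∀ r > β_rot(y), ∃ C, ∀ n, A_n(y) ≤ C rⁿ`.  Discharged in `HexSAWArmchairUnfolding.lean` (the unfolding with inserted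
edges, multiplicity `e^{O(√n log n)}`).
[cite: Beaton2014RotatedHoneycomb, §3.1, proof of Proposition 7 (arXiv v3 pp. 12–13: "fixed-length unfolding"; p. 13: "C^+_n(y) ≤ 4(1+1/y²) e^{c√m_n} U^+_{m_n}(y)"); HammersleyTorrieWhittington1982, §2] -/
def ArchBound (y : ℝ) : Prop := ∀ r : ℝ, armRate y < r → ∃ C : ℝ, ∀ n : ℕ, Aw n y ≤ C * r ^ n

/-- `c_m(ℍ) ≤ C_s sᵐ` for every `s > μ` (from `c_m ≤ μ e^{6√m} μ^m`). [cite: HammersleyWelsh1962, Theorem; MadrasSlade1993, Theorem 3.1.1] -/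
theorem exists_hexSawCount_le_pow {s : ℝ} (hs : hexConnectiveConstant < s) : ∃ C : ℝ, 0 < C ∧ ∀ m : ℕ, (hexSawCount m : ℝ) ≤ C * s ^ m := by
  have hμ := hexConnectiveConstant_pos
  have hq : 1 < s / hexConnectiveConstant := (one_lt_div hμ).2 hs
  -- `e^{6√m} ≤ (s/μ)^m` eventually: `6√m ≤ m log(s/μ)`
  have hlog : 0 < Real.log (s / hexConnectiveConstant) := Real.log_pos hq
  have hev : ∀ᶠ m : ℕ in atTop, Real.exp (6 * Real.sqrt m) ≤ (s / hexConnectiveConstant) ^ m := by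
    have h36 : ∀ᶠ m : ℕ in atTop, (36 / Real.log (s / hexConnectiveConstant) ^ 2) ≤ (m : ℝ) :=
      tendsto_natCast_atTop_atTop.eventually_ge_atTop _
    filter_upwards [h36] with m hm
    have hm0 : (0 : ℝ) ≤ m := Nat.cast_nonneg m
    rw [← Real.exp_log (pow_pos (lt_trans hμ hs |> fun h => div_pos (hμ.trans hs) hμ) m), Real.exp_le_exp, Real.log_pow]
    -- `6 √m ≤ m L` ⟸ `36 m ≤ m² L²` ⟸ `36 ≤ m L²`
    have hL := hlog
    have h1 : 6 * Real.sqrt m = Real.sqrt (36 * m) := by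
      rw [Real.sqrt_mul' 36 hm0, show (36 : ℝ) = 6 ^ 2 by norm_num, Real.sqrt_sq (by norm_num)]
    rw [h1]
    calc Real.sqrt (36 * m) ≤ Real.sqrt ((m * Real.log (s / hexConnectiveConstant)) ^ 2) := by
          apply Real.sqrt_le_sqrt
          have : 36 ≤ (m : ℝ) * Real.log (s / hexConnectiveConstant) ^ 2 := by
            rwa [div_le_iff₀ (pow_pos hL 2)] at hm
          nlinarith
      _ = m * Real.log (s / hexConnectiveConstant) := Real.sqrt_sq (mul_nonneg hm0 hL.le)
  obtain ⟨N, hN⟩ := eventually_atTop.1 hev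
  -- constant: cover `m ≤ N` by a finite maximum
  set C₀ := (Finset.range (N + 1)).sup' ⟨0, by simp⟩ fun m => (hexSawCount m : ℝ) / s ^ m with hC₀
  have hs0 : 0 < s := hμ.trans hs
  refine ⟨max C₀ hexConnectiveConstant + 1, by positivity, fun m => ?_⟩
  rcases Nat.lt_or_ge m (N + 1) with hm | hm
  · have h1 : (hexSawCount m : ℝ) / s ^ m ≤ C₀ := Finset.le_sup' (fun m => (hexSawCount m : ℝ) / s ^ m) (Finset.mem_range.2 hm)
    rw [div_le_iff₀ (pow_pos hs0 m)] at h1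
    calc (hexSawCount m : ℝ) ≤ C₀ * s ^ m := h1
      _ ≤ (max C₀ hexConnectiveConstant + 1) * s ^ m :=
          mul_le_mul_of_nonneg_right (by linarith [le_max_left C₀ hexConnectiveConstant]) (pow_nonneg hs0.le _)
  · have h := hexSawCount_le_mu_mul_exp_mul_pow m
    calc (hexSawCount m : ℝ) ≤ hexConnectiveConstant * Real.exp (6 * Real.sqrt m) * hexConnectiveConstant ^ m := h
      _ ≤ hexConnectiveConstant * (s / hexConnectiveConstant) ^ m * hexConnectiveConstant ^ m :=
          mul_le_mul_of_nonneg_right (mul_le_mul_of_nonneg_left (hN m (by omega)) hμ.le) (pow_nonneg hμ.le _)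
      _ = hexConnectiveConstant * s ^ m := by
          rw [mul_assoc, ← mul_pow, div_mul_cancel₀ _ hμ.ne']
      _ ≤ (max C₀ hexConnectiveConstant + 1) * s ^ m :=
          mul_le_mul_of_nonneg_right (by linarith [le_max_right C₀ hexConnectiveConstant]) (pow_nonneg hs0.le _)

/-- **`C^w_n(y) ≤ C (n+1) rⁿ` for every `r > max(β_rot(y), μ)`**, GIVEN the face «ARM-ARCH-BOUND».
[cite: Beaton2014RotatedHoneycomb, §3.1, proof of Proposition 7 (arXiv v3 p. 14: "limsup C^+_n(y)^{1/n} ≤ μ(y)")] -/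
theorem Cw_le_of_archBound (hy : 0 < y) (hA : ArchBound y) {r : ℝ} (hr : max (armRate y) hexConnectiveConstant < r) :
    ∃ C : ℝ, ∀ n : ℕ, Cw n y ≤ C * (n + 1) * r ^ n := by
  obtain ⟨hβr, hμr⟩ := max_lt_iff.1 hr
  obtain ⟨C₁, hC₁⟩ := hA r hβr
  obtain ⟨C₂, hC₂0, hC₂⟩ := exists_hexSawCount_le_pow hμr
  have hr0 : 0 < r := (armRate_pos y).trans hβr
  have hC₁0 : 0 ≤ C₁ := by
    have := (Aw_nonneg 0 hy.le).trans (hC₁ 0)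
    simpa using this
  refine ⟨C₁ * C₂, fun n => ?_⟩
  calc Cw n y ≤ ∑ k ∈ range (n + 1), Aw k y * #(saws (n - k)) := Cw_le_sum n hy.le
    _ ≤ ∑ k ∈ range (n + 1), C₁ * r ^ k * (C₂ * r ^ (n - k)) := by
        refine Finset.sum_le_sum fun k hk => ?_
        rw [card_saws]
        exact mul_le_mul (hC₁ k) (hC₂ (n - k)) (Nat.cast_nonneg _) (mul_nonneg hC₁0 (pow_nonneg hr0.le _))
    _ = ∑ k ∈ range (n + 1), C₁ * C₂ * r ^ n := by
        refine Finset.sum_congr rfl fun k hk => ?_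
        have hkn : k ≤ n := Nat.le_of_lt_succ (Finset.mem_range.1 hk)
        have : r ^ k * r ^ (n - k) = r ^ n := by rw [← pow_add, Nat.add_sub_cancel' hkn]
        calc C₁ * r ^ k * (C₂ * r ^ (n - k)) = C₁ * C₂ * (r ^ k * r ^ (n - k)) := by ring
          _ = C₁ * C₂ * r ^ n := by rw [this]
    _ = C₁ * C₂ * (n + 1) * r ^ n := by rw [Finset.sum_const, Finset.card_range, nsmul_eq_mul]; push_cast; ring

/-- **`limsup_n C^w_n(y)^{1/n} ≤ max(β_rot(y), μ)`**, rate form, GIVEN the face: for every `r > max(β_rot(y), μ)`, eventually `C^w_n(y) ≤ rⁿ`.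
[cite: Beaton2014RotatedHoneycomb, §3.1, proof of Proposition 7 (arXiv v3 p. 14)] -/
theorem eventually_Cw_le_pow (hy : 0 < y) (hA : ArchBound y) {r : ℝ} (hr : max (armRate y) hexConnectiveConstant < r) :
    ∀ᶠ n : ℕ in atTop, Cw n y ≤ r ^ n := by
  set s := (max (armRate y) hexConnectiveConstant + r) / 2 with hs
  have hs1 : max (armRate y) hexConnectiveConstant < s := by rw [hs]; linarith
  have hsr : s < r := by rw [hs]; linarith
  have hs0 : 0 < s := lt_of_le_of_lt (le_max_of_le_left (armRate_pos y).le) hs1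
  obtain ⟨C, hC⟩ := Cw_le_of_archBound hy hA hs1
  -- `C (n+1) sⁿ ≤ rⁿ` eventually: `(r/s)^n ≥ C(n+1)` since `(r/s)^n / n → ∞`.
  have hq : 1 < r / s := (one_lt_div hs0).2 hsr
  have hev : ∀ᶠ n : ℕ in atTop, C * (n + 1) ≤ (r / s) ^ n := by
    have ht := (tendsto_pow_atTop_atTop_of_one_lt hq)
    -- use `n + 1 ≤ (r/s)^{n} · ε`-type: from `tendsto_pow_const_div_const_pow_of_one_lt`? We argue with √: `(√q)^n ≥ n+1` and `(√q)^n ≥ C` eventually.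
    have hq2 : 1 < Real.sqrt (r / s) := by
      rw [show (1 : ℝ) = Real.sqrt 1 by rw [Real.sqrt_one]]
      exact Real.sqrt_lt_sqrt zero_le_one hq
    have hA1 := (tendsto_pow_atTop_atTop_of_one_lt hq2).eventually_ge_atTop (max C 0)
    -- `n + 1 ≤ (√q)^n` eventually: Bernoulli-free, from `tendsto_pow_div...`: use `Real.add_one_le_exp`-style? take it from `tendsto_atTop` of `q^n/n`.
    have hB := ((tendsto_pow_const_div_const_pow_of_one_lt 1 hq2).eventually (eventually_le_nhds (show (0:ℝ) < 1/2 by norm_num))).and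
      (eventually_ge_atTop 1)
    filter_upwards [hA1, hB] with n hn ⟨hn2, hn1⟩
    have hqn : 0 < Real.sqrt (r / s) ^ n := pow_pos (lt_trans one_pos hq2) n
    have hn1' : (1 : ℝ) ≤ n := by exact_mod_cast hn1
    rw [pow_one, div_le_iff₀ hqn] at hn2
    have e : (r / s) ^ n = Real.sqrt (r / s) ^ n * Real.sqrt (r / s) ^ n := by
      rw [← mul_pow, Real.mul_self_sqrt (le_of_lt (lt_trans one_pos hq))]
    rw [e]
    have h1 : C * (n + 1) ≤ max C 0 * (2 * n) := by
      calc C * (n + 1) ≤ max C 0 * (n + 1) := mul_le_mul_of_nonneg_right (le_max_left _ _) (by positivity)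
        _ ≤ max C 0 * (2 * n) := mul_le_mul_of_nonneg_left (by linarith) (le_max_right _ _)
    calc C * (n + 1) ≤ max C 0 * (2 * n) := h1
      _ ≤ Real.sqrt (r / s) ^ n * (2 * n) := mul_le_mul_of_nonneg_right hn (by positivity)
      _ ≤ Real.sqrt (r / s) ^ n * Real.sqrt (r / s) ^ n := mul_le_mul_of_nonneg_left (by linarith) hqn.le
  filter_upwards [hev] with n hn
  have hsn : 0 < s ^ n := pow_pos hs0 n
  calc Cw n y ≤ C * (n + 1) * s ^ n := hC n
    _ ≤ (r / s) ^ n * s ^ n := mul_le_mul_of_nonneg_right hn hsn.le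
    _ = r ^ n := by rw [div_pow, div_mul_cancel₀ _ hsn.ne']

end Literature.Probability.RandomPlanarGeometry.SAW.HexBW.Arm
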